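import Literature.NumberTheory.LFunctions.RobinLiThetaOscillation
import Literature.NumberTheory.LFunctions.MiscArithmeticRHEquivalents
import Literature.NumberTheory.LFunctions.SchoenfeldExplicitNumerics
import Mathlib.GroupTheory.Perm.Cycle.PossibleTypes
import Mathlib.Analysis.SpecialFunctions.Log.Monotone
import HarnessLib

/-!
# RH-FREE — Massias–Nicolas–Robin 1988, Lemma C (i) and the `Ω₊` half of Thm. 1 (ii): if RH fails, `log g(n) > √(li⁻¹(n))` for infinitely many `n` (`g` = Landau's function); the `⟸` half of the symmetric-group criterion `MassiasNicolasRobin1988_iff` PROVED (Broughan vol. 1, Ch. 10); nothing here bears on the truth of RH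

RH-FREE (oscillation theorems "at a zero `ρ₀` of `ζ`" and implications from `¬RH`; the last two
declarations are RH-EQUIVALENT book-keeping over the remaining named fact `DelegliseNicolas2019_iff`;
nothing is asserted about RH). Literature-typing tranche `rh-lit-broughan-1` (Broughan, *Equivalents
of the Riemann Hypothesis* vol. 1, CUP 2017, Ch. 10 "Other equivalents", the symmetric-group
criterion: "RH `⟺ log g(n) < √(Li⁻¹(n))` for sufficiently large `n`", `g(n)` = the maximal order of
an element of `S_n`; typed in `MiscArithmeticRHEquivalents.lean` §F as the NAMED FACTS
`MassiasNicolasRobin1988_iff` and `DelegliseNicolas2019_iff`). Here the `⟸` half is PROVED, following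
the printed source, Massias–Nicolas–Robin, *Acta Arith.* 50 (1988) 221–242 (read from the journal
scan, pp. 222–235):

* **Thm. 1 (ii)** (p. 224): "Si `θ > 1/2` on a pour tout `ξ < θ`:
  `log g(n) = √(Li⁻¹(n)) + Ω±((n log n)^{ξ/2})`"; **(iv)** "si l'hypothèse de Riemann est vraie,
  `log g(n) < √(Li⁻¹(n))` pour `n` assez grand". The criterion's `⟸` half is the `Ω₊` part of (ii).
* **§5 Lemme C (i)** (p. 231): for `ξ < Θ` and `0 ≤ r ≤ 1`,
  `Π_r(x) = Li(x^{r+1}) + (x^r/log x)(ψ(x) − x) + Ω±(x^{ξ+r})` (`Π_r(x) = ∑_{p^m ≤ x} p^{rm}/m`), proved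
  (pp. 232–233) by **Landau's theorem** applied to
  `K(x) = log x · Li(x^{r+1}) − log x · Π_r(x) + x^r ψ(x) − x^{r+1}`, whose Mellin transform is
  `𝔐(K)(s) = −log((s−r−1)ζ(s−r))/s² + (1/s)(1/(s−r−1) + ζ'/ζ(s−r)) − ((1/(s−r)) ζ'/ζ(s−r) + 1/(s−r−1)) + k(s)`,
  "pour `0 < r ≤ 1`, la singularité dominante est un pôle donc `K(x) = Ω±(x^{θ+r})`".
* **§6** (p. 234): "la convexité de la fonction `t → Li(t²)` donne
  `Li(ψ²(x₁)) ≥ Li(x₁²) + (x₁/log x₁)(ψ(x₁) − x₁)` et le lemme C fournit avec (28) le résultat en `Ω₊`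
  de (ii)".

## What is proved (namespace `LandauFnOmega` unless stated)

* Objects (`r = 1`): `primePowerPi1` (`Π₁(x) = ∑_{n≤x} Λ(n) n/log n`), `liSq`
  (`J(x) = Li(max(2,x)²) − Li(4) = li(x²) − li(4)`, via the tree's `offsetLogIntegral`), `pOne = Π₁ − J`,
  `mnrK` (`K(x) = x(ψ(x) − x) − P₁(x) log x`, MNR's `K` up to `li(4) log x`), with bounds,
  measurability, `J' = x/log x`.
* Transforms on `Re s > 2` (all with the tree's `Landau.mellinIoi`, `PiLi.lamTilde = D − E` for
  "`log((u−1)ζ(u))`", `PiLi.qFn`, Mathlib's entire `ζ₁ = riemannZeta₁`):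
  `mellinIoi_id_mul_psi_sub` (`x(ψ−x) ↦ −(ζ₁'/ζ₁(s−1)+1)/(s−1)`), `mellinIoi_primePowerPi1`
  (`Π₁ ↦ D(s−1)/s`, Mathlib's `LSeries_eq_mul_integral'`), `mellinIoi_liSq` (`J ↦ E(s−1)/s`, by parts),
  `mellinIoi_pOne` (`P₁ ↦ Λ̃(s−1)/s`), `mellinIoi_pOne_mul_log` (`−(d/ds)`), `mellinIoi_mnrK`
  (MNR's `𝔐(K)`), `mellinIoi_cmp`.
* **`false_of_eventually_le`** / **`frequently_le_mnrK_and_mnrK_le`** — Lemme C (i), `r = 1`, at a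
  zero `ρ₀`, for every `0 < b < Re ρ₀` and `c > 0`: `K(x) ≥ c x^{1+b}` and `K(x) ≤ −c x^{1+b}` each
  hold for arbitrarily large `x`. Landau's lemma (the tree's
  `Landau.integrableOn_of_differentiableOn_union_convex`, MV Lemma 15.1) is run as in the tree's
  `RobinLiThetaOscillation.lean` / `PiLiOscillationFromZero.lean` (primitive of `ζ₁'/ζ₁ + q` on the
  hole-free region, shifted by `1`). DEVIATION from MNR's pole/Landau-(ii) endgame: since `b < Re ρ₀`
  strictly, no local analysis at the pole is needed; instead, once the transform `F` is holomorphic on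
  `H = {Re s > 1+b}`, the first-order relation `R = −Λ̃'(s−1)/(s(s−1)) − Λ̃(s−1)/s²`
  (`R = η(c/(s−a) − F) − (q(s−1)−1)/(s−1)`) is integrated with the factor `e^s/s`
  (`(e^s Λ̃(s−1)/s)' = −e^s (s−1) R`) over the hole-free half-plane (the tree's
  `Complex.isExactOn_of_compl`, Conway VIII.2.2), which continues `Λ̃(s−1)` and hence `ζ₁'/ζ₁(s−1)`
  holomorphically to `H ∋ 1 + ρ₀`; a holomorphic logarithmic derivative of the entire `ζ₁(s−1)` on `H`
  kills the zero (`PsiOmega.eq_zero_of_deriv_eq_mul`, `ζ₁(1) = 1`).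
* Arithmetic: `primeSum N = ∑_{p≤N} p`; **`primorial_le_landauFn_primeSum`** (`N# ≤ g(∑_{p≤N} p)`: the
  permutation with one `p`-cycle per prime, Mathlib's `Equiv.Perm.exists_with_cycleType_iff`), hence
  `theta_le_log_landauFn_primeSum` (`θ(x) ≤ log g(∑_{p≤x} p)`); `primeSum_le_primePowerPi1`;
  **`mul_div_log_le_liSq_sub`** (the convexity of `t ↦ li(t²)`: `J(y) − J(x) ≥ (y−x) x/log x` for
  `x, y ≥ e`); `logIntegral_sq_eq`, `exists_logIntegral_eq` (`li` takes every value `≥ 2`).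
* **`exists_sqrt_lt_log_landauFn_of_not_riemannHypothesis`** — MNR Thm. 1 (ii), `Ω₊` part, sign
  form: `¬RH ⟹` for every `N` there are `n ≥ N`, `y > 1` with `li(y) = n` and `√y < log g(n)`.
  DEVIATION: MNR evaluate at every `n` through the element `N ∈ G` of their §4 next to `g(n)`; for
  the `Ω₊` statement it suffices to take `n = ∑_{p≤x} p`, where `g(n) ≥ x#` directly, so §4 (the
  structure of `G`) is not needed; the passage `ψ → θ`, `Π₁ → ∑ p` costs `O(x^{3/2} log x) = o(x^{1+b})`
  because `b > 1/2` (exactly as MNR use `θ > 1/2`).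
* (appended) **`exists_sqrt_add_rpow_le_log_landauFn`** — the same with the printed magnitude: at a
  zero `ρ₀` with `Re ρ₀ > 1/2`, for every `ξ < Re ρ₀` and every `N` there are `n ≥ N`, `y > 1` with
  `li(y) = n` and `log g(n) ≥ √y + (n log n)^{ξ/2}` (MNR Thm. 1 (ii): "`Ω±((n log n)^{ξ/2})` pour tout
  `ξ < θ`", the `Ω₊` part); `exists_gt_quarter_sqrt_add_rpow_le_of_not_riemannHypothesis` (`¬RH ⟹ ∃ b > 1/4`
  with `log g(n) ≥ √(li⁻¹(n)) + (n log n)^b` infinitely often, the form recalled in Deléglise–Nicolas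
  2019, (1.12)).
* **`riemannHypothesis_of_eventually_log_landauFn_lt`** — the `⟸` half of the criterion, PROVED;
  `MassiasNicolasRobin1988_iff_of_delegliseNicolas2019` — the named fact `MassiasNicolasRobin1988_iff`
  now follows from `DelegliseNicolas2019_iff` alone (its `⟹` half = MNR Thm. 1 (iv), explicit-formula
  numerics, not attempted here); `frequently_sqrt_liInv_lt_log_landauFn_of_not_riemannHypothesis`.

No new named fact is introduced. AS-PRINTED FLAGS: `li⁻¹` is encoded as in §F of
`MiscArithmeticRHEquivalents.lean` (`∀ y > 1, li y = n → …`; `li = logIntegral`); MNR's `Li` is the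
principal-value `li` (their §2), so "`Li(x²)`" is our `li(x²) = J(x) + li(4)`.

## References

* J.-P. Massias, J.-L. Nicolas, G. Robin, *Évaluation asymptotique de l'ordre maximum d'un élément du
  groupe symétrique*, Acta Arith. 50 (1988) 221–242: Thm. 1 (p. 224), §4 (pp. 226–228), §5 Lemmes A–C
  (pp. 228–233), §6 (pp. 233–235). [MassiasNicolasRobin1988] (held: [corpus:paper:doi-10-4064-aa-50-3-221-242],
  journal scan read pp. 221–235)
* M. Deléglise, J.-L. Nicolas, *The Landau function and the Riemann hypothesis*, J. Comb. Number
  Theory 11 (2019), (1.5), Thm. 1.1, Cor. 1.3. [DelegliseNicolas2019]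
* H. L. Montgomery, R. C. Vaughan, *Multiplicative Number Theory I*, §15.1, Lemma 15.1, Thm. 15.2.
  [MontgomeryVaughan2007]
* J. B. Conway, *Functions of One Complex Variable I*, Thm. VIII.2.2. [Conway1978]
* K. Broughan, *Equivalents of the Riemann Hypothesis* vol. 1, CUP 2017, Ch. 10 (symmetric group).
  [Broughan2017Arithmetic] (not held, acq-00318)
-/

noncomputable section

open Complex Filter Topology Set MeasureTheory ArithmeticFunction
open scoped Chebyshev

namespace Literature.NumberTheory.LFunctions

namespace LandauFnOmega

open Landau Nicolas PiLi

/-! ### Generic helpers -/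

/-- A measurable `g` with `|g(x)| ≤ C x^a` on `(1, ∞)` has `∫_1^∞ |g| x^{-(σ+1)} dx < ∞` for `σ > a`. [folklore] -/
private theorem integrableOn_rpow_of_abs_le_mul_rpow {g : ℝ → ℝ} (hg : Measurable g) {C a : ℝ}
    (hC : ∀ x, 1 < x → |g x| ≤ C * x ^ a) {σ : ℝ} (hσ : a < σ) :
    IntegrableOn (fun x ↦ g x * x ^ (-(σ + 1))) (Ioi 1) := by
  have h1 : IntegrableOn (fun x : ℝ ↦ C * x ^ (a - (σ + 1))) (Ioi 1) :=
    (integrableOn_Ioi_rpow_of_lt (by linarith) zero_lt_one).const_mul C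
  refine Integrable.mono' h1 ((hg.mul (measurable_id.pow_const _))).aestronglyMeasurable ?_
  rw [ae_restrict_iff' measurableSet_Ioi]
  refine Eventually.of_forall fun x (hx : 1 < x) ↦ ?_
  have hx0 : 0 < x := zero_lt_one.trans hx
  rw [norm_mul, Real.norm_eq_abs, Real.norm_eq_abs, abs_of_pos (Real.rpow_pos_of_pos hx0 _)]
  have hpow : x ^ a * x ^ (-(σ + 1)) = x ^ (a - (σ + 1)) := by
    rw [show a - (σ + 1) = a + (-(σ + 1)) by ring, Real.rpow_add hx0]
  calc |g x| * x ^ (-(σ + 1)) ≤ C * x ^ a * x ^ (-(σ + 1)) :=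
        mul_le_mul_of_nonneg_right (hC x hx) (Real.rpow_nonneg hx0.le _)
    _ = C * x ^ (a - (σ + 1)) := by rw [mul_assoc, hpow]

/-- Weighting by `x` shifts the transform: `∫_1^∞ x g(x) x^{-s-1} dx = ∫_1^∞ g(x) x^{-(s-1)-1} dx`
(MNR: `𝔐(x^r ψ(x))(s) = 𝔐(ψ)(s − r)`). [cite: MassiasNicolasRobin1988, §5 proof of Lemme C (𝔐(x^r ψ))] -/
theorem mellinIoi_id_mul (g : ℝ → ℝ) (s : ℂ) :
    mellinIoi (fun x ↦ x * g x) s = mellinIoi g (s - 1) := by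
  unfold mellinIoi
  refine setIntegral_congr_fun measurableSet_Ioi fun x hx ↦ ?_
  have hx0 : 0 < x := zero_lt_one.trans hx
  push_cast
  rw [show -(s - 1 + 1) = -s by ring, ← PiOmega.ofReal_mul_cpow_neg_add_one hx0 s]
  ring

/-! ### The objects: `Π₁(x) = ∑_{n ≤ x} Λ(n) n/log n`, `J(x) = Li(x²) − Li(4)`, `P₁ = Π₁ − J`, and MNR's `K` -/

/-- MNR's `Π₁(x) = ∑_{p^m ≤ x} p^m/m = ∑_{n ≤ x} Λ(n) n/log n` (the case `r = 1` of
`Π_r(x) = ∑_{p^m ≤ x} p^{rm}/m`). [cite: MassiasNicolasRobin1988, §2 (notation Π_r)] -/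
def primePowerPi1 (x : ℝ) : ℝ := ∑ n ∈ Finset.Ioc 0 ⌊x⌋₊, Λ n * (n : ℝ) / Real.log n

/-- `J(x) = Li(max(2,x)²) − Li(4) = ∫_2^{max(2,x)} t dt/log t` (`= li(x²) − li(4)` for `x ≥ 2`): the
`x`-weighted logarithmic integral, MNR's `Li(x^{r+1})` for `r = 1` up to the constant `li(4)`.
[cite: MassiasNicolasRobin1988, §2 (notation Li) and §5 Lemme C] -/
def liSq (x : ℝ) : ℝ := offsetLogIntegral (max 2 x ^ 2) - offsetLogIntegral 4

/-- `P₁ = Π₁ − J`. [cite: MassiasNicolasRobin1988, §5 Lemme C (i) (r = 1)] -/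
def pOne (x : ℝ) : ℝ := primePowerPi1 x - liSq x

/-- MNR's function `K(x) = log x · Li(x²) − log x · Π₁(x) + x ψ(x) − x²` (proof of Lemme C, `r = 1`),
here `K(x) = x(ψ(x) − x) − P₁(x) log x` (the same up to `li(4) log x`).
[cite: MassiasNicolasRobin1988, §5 proof of Lemme C (the function K)] -/
def mnrK (x : ℝ) : ℝ := x * (ψ x - x) - pOne x * Real.log x

/-! ### Elementary bounds and measurability -/

/-- `0 ≤ Π₁(x)`. [folklore] -/
private theorem primePowerPi1_nonneg (x : ℝ) : 0 ≤ primePowerPi1 x :=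
  Finset.sum_nonneg fun n _ ↦ div_nonneg (mul_nonneg vonMangoldt_nonneg (Nat.cast_nonneg n))
    (Real.log_natCast_nonneg n)

/-- `Π₁(x) ≤ x²` for `x ≥ 0` (each of the `⌊x⌋` terms is `≤ n ≤ x`). [folklore] -/
private theorem primePowerPi1_le {x : ℝ} (hx : 0 ≤ x) : primePowerPi1 x ≤ x ^ 2 := by
  unfold primePowerPi1
  have hterm : ∀ n ∈ Finset.Ioc 0 ⌊x⌋₊, Λ n * (n : ℝ) / Real.log n ≤ x := by
    intro n hn
    have hnx : (n : ℝ) ≤ x := by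
      have := (Finset.mem_Ioc.1 hn).2
      exact le_trans (by exact_mod_cast this) (Nat.floor_le hx)
    have h1 : Λ n / Real.log n ≤ 1 := PiOmega.vonMangoldt_div_log_le_one n
    calc Λ n * (n : ℝ) / Real.log n = (Λ n / Real.log n) * n := by ring
      _ ≤ 1 * n := mul_le_mul_of_nonneg_right h1 (Nat.cast_nonneg n)
      _ ≤ x := by rw [one_mul]; exact hnx
  calc ∑ n ∈ Finset.Ioc 0 ⌊x⌋₊, Λ n * (n : ℝ) / Real.log n ≤ (Finset.Ioc 0 ⌊x⌋₊).card • x :=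
        Finset.sum_le_card_nsmul _ _ _ hterm
    _ = (⌊x⌋₊ : ℝ) * x := by simp
    _ ≤ x * x := mul_le_mul_of_nonneg_right (Nat.floor_le hx) hx
    _ = x ^ 2 := by ring

/-- Measurability of `Π₁` (a function of `⌊x⌋`). [folklore] -/
private theorem measurable_primePowerPi1 : Measurable primePowerPi1 := by
  have : primePowerPi1 = (fun m : ℕ ↦ ∑ n ∈ Finset.Ioc 0 m, Λ n * (n : ℝ) / Real.log n) ∘ Nat.floor := by
    funext x; rfl
  rw [this]
  exact (measurable_from_nat (f := fun m : ℕ ↦ ∑ n ∈ Finset.Ioc 0 m, Λ n * (n : ℝ) / Real.log n)).comp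
    Nat.measurable_floor

/-- `J = 0` on `(−∞, 2]`. [folklore] -/
private theorem liSq_of_le_two {x : ℝ} (hx : x ≤ 2) : liSq x = 0 := by
  unfold liSq
  rw [max_eq_left hx]
  norm_num

/-- `J(x) = Li(x²) − Li(4)` for `x ≥ 2`. [folklore] -/
private theorem liSq_of_two_le {x : ℝ} (hx : 2 ≤ x) : liSq x = offsetLogIntegral (x ^ 2) - offsetLogIntegral 4 := by
  unfold liSq
  rw [max_eq_right hx]

/-- `J(x) = ∫_4^{x²} dt/log t` for `x ≥ 2`. [folklore] -/
private theorem liSq_eq_integral {x : ℝ} (hx : 2 ≤ x) :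
    liSq x = ∫ t in (4 : ℝ)..x ^ 2, (Real.log t)⁻¹ := by
  rw [liSq_of_two_le hx]
  exact offsetLogIntegral_sub_offsetLogIntegral (by norm_num) (by nlinarith)

/-- `0 ≤ J(x) ≤ x²` for `x ≥ 0`. [folklore] -/
private theorem liSq_bounds {x : ℝ} (hx : 0 ≤ x) : 0 ≤ liSq x ∧ liSq x ≤ x ^ 2 := by
  rcases le_or_gt x 2 with h2 | h2
  · rw [liSq_of_le_two h2]; exact ⟨le_rfl, sq_nonneg x⟩
  rw [liSq_eq_integral h2.le]
  have h4 : (4 : ℝ) ≤ x ^ 2 := by nlinarith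
  have hlog4 : 1 < Real.log 4 := by
    rw [Real.lt_log_iff_exp_lt (by norm_num)]
    have := Real.exp_one_lt_d9; linarith
  constructor
  · refine intervalIntegral.integral_nonneg h4 fun t ht ↦ ?_
    have : 1 ≤ Real.log t := by
      have := Real.log_le_log (by norm_num) ht.1; linarith
    positivity
  · have hb : ‖∫ t in (4 : ℝ)..x ^ 2, (Real.log t)⁻¹‖ ≤ 1 * |x ^ 2 - 4| := by
      refine intervalIntegral.norm_integral_le_of_norm_le_const fun t ht ↦ ?_
      rw [Set.uIoc_of_le h4] at ht
      have hlt : 1 < Real.log t := by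
        have := Real.log_le_log (by norm_num) ht.1.le; linarith
      rw [Real.norm_eq_abs, abs_of_pos (inv_pos.2 (by linarith))]
      exact inv_le_one_of_one_le₀ hlt.le
    rw [Real.norm_eq_abs, one_mul, abs_of_nonneg (by linarith : (0:ℝ) ≤ x ^ 2 - 4)] at hb
    have := le_abs_self (∫ t in (4 : ℝ)..x ^ 2, (Real.log t)⁻¹)
    linarith

/-- `J` is continuous (`Li` is continuous on `(1, ∞)` and `max(2,x)² ≥ 4`). [folklore] -/
private theorem continuous_liSq : Continuous liSq := by
  unfold liSq
  refine Continuous.sub ?_ continuous_const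
  have h : Continuous fun x : ℝ ↦ max 2 x ^ 2 := (continuous_const.max continuous_id).pow 2
  exact continuousOn_offsetLogIntegral.comp_continuous h fun x ↦ by
    show (1 : ℝ) < max 2 x ^ 2
    nlinarith [le_max_left (2 : ℝ) x]

/-- Measurability of `J`. [folklore] -/
private theorem measurable_liSq : Measurable liSq := continuous_liSq.measurable

/-- `J'(x) = x/log x` for `x > 2` (`(d/dx) Li(x²) = 2x/log(x²)`; MNR (18): "la formule de Taylor
appliquée à la fonction `u → Li(u^{r+1})`"). [cite: MassiasNicolasRobin1988, §5 (18)] -/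
theorem hasDerivAt_liSq {x : ℝ} (hx : 2 < x) : HasDerivAt liSq (x / Real.log x) x := by
  have hx0 : 0 < x := by linarith
  have h1 : HasDerivAt (fun y : ℝ ↦ offsetLogIntegral (y ^ 2) - offsetLogIntegral 4)
      ((Real.log (x ^ 2))⁻¹ * (2 * x)) x := by
    have hsq : HasDerivAt (fun y : ℝ ↦ y ^ 2) (2 * x) x := by
      simpa using hasDerivAt_pow 2 x
    have hLi : HasDerivAt offsetLogIntegral (Real.log (x ^ 2))⁻¹ ((fun y : ℝ ↦ y ^ 2) x) :=
      hasDerivAt_offsetLogIntegral_holds (by show (1:ℝ) < x ^ 2; nlinarith)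
    have h : HasDerivAt (offsetLogIntegral ∘ fun y : ℝ ↦ y ^ 2) ((Real.log (x ^ 2))⁻¹ * (2 * x)) x :=
      HasDerivAt.comp x hLi hsq
    exact h.sub_const _
  have h2 : (Real.log (x ^ 2))⁻¹ * (2 * x) = x / Real.log x := by
    rw [Real.log_pow]; push_cast
    have : Real.log x ≠ 0 := (Real.log_pos (by linarith)).ne'
    field_simp
  rw [h2] at h1
  refine h1.congr_of_eventuallyEq ?_
  filter_upwards [lt_mem_nhds hx] with y hy
  exact liSq_of_two_le hy.le

/-- `|P₁(x)| ≤ x²` for `x ≥ 0`. [folklore] -/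
private theorem abs_pOne_le {x : ℝ} (hx : 0 ≤ x) : |pOne x| ≤ x ^ 2 := by
  obtain ⟨h1, h2⟩ := liSq_bounds hx
  have h3 := primePowerPi1_nonneg x
  have h4 := primePowerPi1_le hx
  unfold pOne
  rw [abs_le]; constructor <;> linarith

/-- Measurability of `P₁`. [folklore] -/
private theorem measurable_pOne : Measurable pOne := measurable_primePowerPi1.sub measurable_liSq

/-- Measurability of `K`. [folklore] -/
private theorem measurable_mnrK : Measurable mnrK :=
  (measurable_id.mul (Nicolas.measurable_psi.sub measurable_id)).sub
    (measurable_pOne.mul Real.measurable_log)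

/-- `|K(x)| ≤ 8 x^{5/2}` for `x > 1` (`|ψ(x) − x| ≤ 6x`, `|P₁| ≤ x²`, `log x ≤ 2√x`). [folklore] -/
private theorem abs_mnrK_le {x : ℝ} (hx : 1 < x) : |mnrK x| ≤ 8 * x ^ (5 / 2 : ℝ) := by
  have hx0 : 0 < x := by linarith
  have h1 : |ψ x - x| ≤ 6 * x := Nicolas.abs_psi_sub_self_le hx0.le
  have h2 : |pOne x| ≤ x ^ 2 := abs_pOne_le hx0.le
  have h3 : Real.log x ≤ 2 * x ^ (1 / 2 : ℝ) := by
    have := Real.log_le_rpow_div hx0.le (show (0:ℝ) < 1 / 2 by norm_num)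
    linarith
  have hlog0 : 0 ≤ Real.log x := Real.log_nonneg hx.le
  have hx52 : x ^ (5 / 2 : ℝ) = x ^ 2 * x ^ (1 / 2 : ℝ) := by
    rw [show (5 / 2 : ℝ) = (2 : ℝ) + 1 / 2 by norm_num, Real.rpow_add hx0]; norm_cast
  have hx2le : x ^ 2 ≤ x ^ (5 / 2 : ℝ) := by
    rw [hx52]
    have : 1 ≤ x ^ (1 / 2 : ℝ) := Real.one_le_rpow hx.le (by norm_num)
    nlinarith
  unfold mnrK
  calc |x * (ψ x - x) - pOne x * Real.log x|
      ≤ |x * (ψ x - x)| + |pOne x * Real.log x| := abs_sub _ _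
    _ = x * |ψ x - x| + |pOne x| * Real.log x := by
        rw [abs_mul, abs_mul, abs_of_pos hx0, abs_of_nonneg hlog0]
    _ ≤ x * (6 * x) + x ^ 2 * (2 * x ^ (1 / 2 : ℝ)) := by
        gcongr
    _ = 6 * x ^ 2 + 2 * x ^ (5 / 2 : ℝ) := by rw [hx52]; ring
    _ ≤ 8 * x ^ (5 / 2 : ℝ) := by linarith

/-! ### Transforms on `Re s > 2` -/

/-- **`∫_1^∞ x(ψ(x) − x) x^{-s-1} dx = −(ζ₁'/ζ₁(s−1) + 1)/(s − 1)`** for `Re s > 2`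
(MV Thm. 1.3 shifted by one: MNR "`𝔐(x^r ψ(x))(s) = −ζ'(s−r)/((s−r)ζ(s−r))`", `r = 1`).
[cite: MassiasNicolasRobin1988, §5 proof of Lemme C (𝔐(x^r ψ))] -/
theorem mellinIoi_id_mul_psi_sub {s : ℂ} (hs : 2 < s.re) :
    mellinIoi (fun x ↦ x * (ψ x - x)) s = -(logDeriv riemannZeta₁ (s - 1) + 1) / (s - 1) := by
  rw [mellinIoi_id_mul, PsiOmega.mellinIoi_psi_sub_self (by simp; linarith)]

/-- The coefficients `Λ(n) n/log n` of `Π₁`. [folklore] -/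
private theorem norm_coeff1_le (n : ℕ) : ‖((Λ n * (n : ℝ) / Real.log n : ℝ) : ℂ)‖ ≤ n := by
  rw [Complex.norm_real, Real.norm_eq_abs,
    abs_of_nonneg (div_nonneg (mul_nonneg vonMangoldt_nonneg (Nat.cast_nonneg n))
      (Real.log_natCast_nonneg n))]
  calc Λ n * (n : ℝ) / Real.log n = (Λ n / Real.log n) * n := by ring
    _ ≤ 1 * n := mul_le_mul_of_nonneg_right (PiOmega.vonMangoldt_div_log_le_one n) (Nat.cast_nonneg n)
    _ = n := one_mul _

/-- The Dirichlet series of `Λ(n) n/log n` is that of `Λ(n)/log n` shifted by one. [folklore] -/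
private theorem LSeries_coeff1 (s : ℂ) :
    LSeries (fun n : ℕ ↦ ((Λ n * (n : ℝ) / Real.log n : ℝ) : ℂ)) s =
      LSeries (fun n : ℕ ↦ ((Λ n / Real.log n : ℝ) : ℂ)) (s - 1) := by
  unfold LSeries
  refine tsum_congr fun n ↦ ?_
  rcases eq_or_ne n 0 with rfl | hn
  · simp [LSeries.term_zero]
  rw [LSeries.term_of_ne_zero hn, LSeries.term_of_ne_zero hn]
  have hn0 : (n : ℂ) ≠ 0 := Nat.cast_ne_zero.2 hn
  have hpow : (n : ℂ) ^ s = (n : ℂ) ^ (s - 1) * n := by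
    conv_lhs => rw [show s = (s - 1) + 1 by ring]
    rw [Complex.cpow_add _ _ hn0, Complex.cpow_one]
  rw [hpow]
  push_cast
  field_simp

/-- **`∫_1^∞ Π₁(x) x^{-s-1} dx = D(s−1)/s`** for `Re s > 2`, `D(u) = ∑ Λ(n)/(log n) n^{-u}`
(MNR: "`𝔐(Π_r(x))(s) = log ζ(s−r)/s + c/s`"; kept log-free as the Dirichlet series).
[cite: MassiasNicolasRobin1988, §5 proof of Lemme C (𝔐(Π_r))] -/
theorem mellinIoi_primePowerPi1 {s : ℂ} (hs : 2 < s.re) :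
    mellinIoi primePowerPi1 s = LSeries (fun n : ℕ ↦ ((Λ n / Real.log n : ℝ) : ℂ)) (s - 1) / s := by
  have hO : (fun n : ℕ ↦ ∑ k ∈ Finset.Icc 1 n, ‖((Λ k * (k : ℝ) / Real.log k : ℝ) : ℂ)‖) =O[atTop]
      fun n ↦ (n : ℝ) ^ (2 : ℝ) := by
    refine Asymptotics.IsBigO.of_bound 1 (Eventually.of_forall fun n ↦ ?_)
    rw [Real.norm_eq_abs, Real.norm_eq_abs, one_mul,
      abs_of_nonneg (Finset.sum_nonneg fun k _ ↦ norm_nonneg _),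
      abs_of_nonneg (by positivity)]
    calc ∑ k ∈ Finset.Icc 1 n, ‖((Λ k * (k : ℝ) / Real.log k : ℝ) : ℂ)‖
        ≤ ∑ k ∈ Finset.Icc 1 n, (n : ℝ) := Finset.sum_le_sum fun k hk ↦
          (norm_coeff1_le k).trans (by exact_mod_cast (Finset.mem_Icc.1 hk).2)
      _ = n * n := by simp
      _ = (n : ℝ) ^ (2 : ℝ) := by norm_cast; ring
  have hs' : (2 : ℝ) < s.re := hs
  have hint := LSeries_eq_mul_integral' (fun n : ℕ ↦ ((Λ n * (n : ℝ) / Real.log n : ℝ) : ℂ))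
    (by norm_num) hs' hO
  have hsum : ∀ t : ℝ, ∑ k ∈ Finset.Icc 1 ⌊t⌋₊, ((Λ k * (k : ℝ) / Real.log k : ℝ) : ℂ) =
      ((primePowerPi1 t : ℝ) : ℂ) := by
    intro t
    rw [primePowerPi1, show (1 : ℕ) = 0 + 1 from rfl, Finset.Icc_add_one_left_eq_Ioc]
    push_cast
    rfl
  simp_rw [hsum] at hint
  have hs0 : s ≠ 0 := by rintro rfl; simp at hs; linarith
  unfold mellinIoi
  rw [← LSeries_coeff1, hint]
  field_simp


/-- Integrability of `J(x) x^{-(σ+1)}`, `Π₁(x) x^{-(σ+1)}`, `P₁(x) x^{-(σ+1)}` on `(1,∞)` for `σ > 2`.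
[folklore] -/
private theorem integrableOn_liSq_rpow {σ : ℝ} (hσ : 2 < σ) :
    IntegrableOn (fun x ↦ liSq x * x ^ (-(σ + 1))) (Ioi 1) :=
  integrableOn_rpow_of_abs_le_mul_rpow measurable_liSq (C := 1) (a := 2)
    (fun x hx ↦ by
      obtain ⟨h0, h2⟩ := liSq_bounds (zero_le_one.trans hx.le)
      rw [abs_of_nonneg h0, one_mul, show (x ^ (2 : ℝ)) = x ^ 2 by norm_cast]; exact h2) hσ

/-- Auxiliary (proof-internal). [folklore] -/
private theorem integrableOn_primePowerPi1_rpow {σ : ℝ} (hσ : 2 < σ) :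
    IntegrableOn (fun x ↦ primePowerPi1 x * x ^ (-(σ + 1))) (Ioi 1) :=
  integrableOn_rpow_of_abs_le_mul_rpow measurable_primePowerPi1 (C := 1) (a := 2)
    (fun x hx ↦ by
      rw [abs_of_nonneg (primePowerPi1_nonneg x), one_mul, show (x ^ (2 : ℝ)) = x ^ 2 by norm_cast]
      exact primePowerPi1_le (zero_le_one.trans hx.le)) hσ

/-- Auxiliary (proof-internal). [folklore] -/
private theorem integrableOn_pOne_rpow {σ : ℝ} (hσ : 2 < σ) :
    IntegrableOn (fun x ↦ pOne x * x ^ (-(σ + 1))) (Ioi 1) :=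
  integrableOn_rpow_of_abs_le_mul_rpow measurable_pOne (C := 1) (a := 2)
    (fun x hx ↦ by
      rw [one_mul, show (x ^ (2 : ℝ)) = x ^ 2 by norm_cast]
      exact abs_pOne_le (zero_le_one.trans hx.le)) hσ

/-- Auxiliary (proof-internal). [folklore] -/
private theorem integrableOn_mnrK_rpow {σ : ℝ} (hσ : 5 / 2 < σ) :
    IntegrableOn (fun x ↦ mnrK x * x ^ (-(σ + 1))) (Ioi 1) :=
  integrableOn_rpow_of_abs_le_mul_rpow measurable_mnrK (fun _ hx ↦ abs_mnrK_le hx) hσ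

/-- **`∫_1^∞ J(x) x^{-s-1} dx = E(s−1)/s`** for `Re s > 2`, where `E(u) = ∫_2^∞ x^{-u} dx/log x`
(integration by parts, `J(2) = 0`, `J' = x/log x`; MNR: "`s ∫_2^∞ Li(x^{r+1}) x^{-s-1} dx =
Li(2^{r+1})/2^s + ∫_2^∞ x^r dx/(x^s log x)`", `r = 1`, with `Li(x²) − Li(4)` in place of `Li(x²)`).
[cite: MassiasNicolasRobin1988, §5 proof of Lemme C (𝔐(Li(x^{r+1}) log x))] -/
theorem mellinIoi_liSq {s : ℂ} (hs : 2 < s.re) :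
    mellinIoi liSq s = (∫ x in Ioi (2 : ℝ), (x : ℂ) ^ (-(s - 1)) / (Real.log x : ℂ)) / s := by
  have hs0 : s ≠ 0 := by rintro rfl; simp at hs; linarith
  -- Step 1: restrict to `(2, ∞)`
  have hstep1 : mellinIoi liSq s =
      ∫ x in Ioi (2 : ℝ), ((liSq x : ℝ) : ℂ) * (x : ℂ) ^ (-(s + 1)) := by
    unfold mellinIoi
    have h1 : ∀ x ∈ Ioi (1 : ℝ), ((liSq x : ℝ) : ℂ) * (x : ℂ) ^ (-(s + 1)) =
        (Ioi (2 : ℝ)).indicator (fun x : ℝ ↦ ((liSq x : ℝ) : ℂ) * (x : ℂ) ^ (-(s + 1))) x := by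
      intro x _
      by_cases h2 : x ∈ Ioi (2 : ℝ)
      · rw [Set.indicator_of_mem h2]
      · rw [Set.indicator_of_notMem h2, liSq_of_le_two (not_lt.1 h2)]
        simp
    rw [setIntegral_congr_fun measurableSet_Ioi h1, setIntegral_indicator measurableSet_Ioi,
      Set.Ioi_inter_Ioi]
    norm_num
  rw [hstep1]
  -- Step 2: integration by parts on `(2, ∞)`
  set u : ℝ → ℂ := fun x ↦ ((liSq x : ℝ) : ℂ) with hu
  set u' : ℝ → ℂ := fun x ↦ ((x / Real.log x : ℝ) : ℂ) with hu'
  set v : ℝ → ℂ := fun x ↦ (x : ℂ) ^ (-s) / (-s) with hv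
  set v' : ℝ → ℂ := fun x ↦ (x : ℂ) ^ (-(s + 1)) with hv'
  have hdu : ∀ x ∈ Ioi (2 : ℝ), HasDerivAt u (u' x) x := fun x hx ↦
    (hasDerivAt_liSq hx).ofReal_comp
  have hdv : ∀ x ∈ Ioi (2 : ℝ), HasDerivAt v (v' x) x := by
    intro x hx
    have hx0 : x ≠ 0 := by simp only [Set.mem_Ioi] at hx; exact (two_pos.trans hx).ne'
    have h := (hasDerivAt_ofReal_cpow_const hx0 (neg_ne_zero.2 hs0)).div_const (-s)
    simp only [hv, hv']
    refine h.congr_deriv ?_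
    rw [show -s - 1 = -(s + 1) by ring]
    field_simp
  have hv'norm : ∀ x : ℝ, 0 < x → ‖v' x‖ = x ^ (-(s.re + 1)) := by
    intro x hx
    simp only [hv', Complex.norm_cpow_eq_rpow_re_of_pos hx]
    simp
  have hvnorm : ∀ x : ℝ, 0 < x → ‖v x‖ = x ^ (-s.re) / ‖s‖ := by
    intro x hx
    simp only [hv, norm_div, norm_neg, Complex.norm_cpow_eq_rpow_re_of_pos hx, neg_re]
  have huv' : IntegrableOn (u * v') (Ioi 2) := by
    refine Integrable.mono'
      ((integrableOn_Ioi_rpow_of_lt (show 1 - s.re < -1 by linarith) two_pos).const_mul 1)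
      ((measurable_ofReal.comp measurable_liSq).mul
        (measurable_ofReal.pow_const _)).aestronglyMeasurable ?_
    rw [ae_restrict_iff' measurableSet_Ioi]
    refine ae_of_all _ fun x hx ↦ ?_
    have hx2 : 2 < x := hx
    have hx0 : 0 < x := by linarith
    obtain ⟨h0, h2⟩ := liSq_bounds hx0.le
    simp only [Pi.mul_apply, norm_mul, hv'norm x hx0, hu, Complex.norm_real, Real.norm_eq_abs,
      abs_of_nonneg h0]
    calc liSq x * x ^ (-(s.re + 1)) ≤ x ^ 2 * x ^ (-(s.re + 1)) :=
          mul_le_mul_of_nonneg_right h2 (Real.rpow_nonneg hx0.le _)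
      _ = 1 * x ^ (1 - s.re) := by
          rw [one_mul, show (x ^ 2 : ℝ) = x ^ (2 : ℝ) by norm_cast, ← Real.rpow_add hx0]
          congr 1; ring
  have hu'v : IntegrableOn (u' * v) (Ioi 2) := by
    refine Integrable.mono'
      ((integrableOn_Ioi_rpow_of_lt (show 1 - s.re < -1 by linarith) two_pos).const_mul (2 / ‖s‖))
      ((measurable_ofReal.comp (measurable_id.div Real.measurable_log)).mul
        ((measurable_ofReal.pow_const _).div_const _)).aestronglyMeasurable ?_
    rw [ae_restrict_iff' measurableSet_Ioi]
    refine ae_of_all _ fun x hx ↦ ?_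
    have hx2 : 2 < x := hx
    have hx0 : 0 < x := by linarith
    have hlog : Real.log 2 ≤ Real.log x := Real.log_le_log two_pos hx2.le
    have hl2 : (1 : ℝ) / 2 < Real.log 2 := by linarith [Real.log_two_gt_d9]
    have hlogpos : 0 < Real.log x := by linarith
    have hinv : x / Real.log x ≤ 2 * x := by
      rw [div_le_iff₀ hlogpos]; nlinarith
    simp only [Pi.mul_apply, norm_mul, hvnorm x hx0, hu', Complex.norm_real, Real.norm_eq_abs,
      abs_of_pos (div_pos hx0 hlogpos)]
    have hspos : 0 < ‖s‖ := norm_pos_iff.2 hs0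
    calc x / Real.log x * (x ^ (-s.re) / ‖s‖) ≤ 2 * x * (x ^ (-s.re) / ‖s‖) := by
          gcongr
      _ = 2 / ‖s‖ * (x ^ (1 : ℝ) * x ^ (-s.re)) := by rw [Real.rpow_one]; ring
      _ = 2 / ‖s‖ * x ^ (1 - s.re) := by rw [← Real.rpow_add hx0]; ring_nf
  have h_zero : Tendsto (u * v) (𝓝[>] (2 : ℝ)) (𝓝 0) := by
    have hc : ContinuousAt (u * v) 2 := by
      refine ((continuous_ofReal.comp continuous_liSq).continuousAt).mul ?_
      simp only [hv]
      refine ContinuousAt.div_const ?_ _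
      exact (continuousAt_ofReal_cpow_const _ _ (Or.inr two_ne_zero))
    have h0 : (u * v) 2 = 0 := by
      simp only [Pi.mul_apply, hu, liSq_of_le_two le_rfl, Complex.ofReal_zero, zero_mul]
    rw [← h0]
    exact hc.tendsto.mono_left nhdsWithin_le_nhds
  have h_infty : Tendsto (u * v) atTop (𝓝 0) := by
    rw [tendsto_zero_iff_norm_tendsto_zero]
    have hlim : Tendsto (fun x : ℝ ↦ 1 / ‖s‖ * x ^ (-(s.re - 2))) atTop (𝓝 0) := by
      have := (tendsto_rpow_neg_atTop (show 0 < s.re - 2 by linarith)).const_mul (1 / ‖s‖)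
      rw [mul_zero] at this
      exact this
    refine squeeze_zero' (Eventually.of_forall fun x ↦ norm_nonneg _) ?_ hlim
    filter_upwards [eventually_gt_atTop 0] with x hx0
    obtain ⟨h0, h2⟩ := liSq_bounds hx0.le
    simp only [Pi.mul_apply, norm_mul, hvnorm x hx0, hu, Complex.norm_real, Real.norm_eq_abs,
      abs_of_nonneg h0]
    calc liSq x * (x ^ (-s.re) / ‖s‖) ≤ x ^ 2 * (x ^ (-s.re) / ‖s‖) := by
          gcongr
      _ = 1 / ‖s‖ * x ^ (-(s.re - 2)) := by
          rw [show (-(s.re - 2)) = 2 + (-s.re) by ring, Real.rpow_add hx0,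
            show (x ^ (2 : ℝ)) = x ^ 2 by norm_cast]
          field_simp
  have hparts := integral_Ioi_mul_deriv_eq_deriv_mul hdu hdv huv' hu'v h_zero h_infty
  rw [hparts, sub_self, zero_sub, ← integral_neg, ← integral_div]
  refine setIntegral_congr_fun measurableSet_Ioi fun x hx ↦ ?_
  have hx0 : 0 < x := two_pos.trans hx
  simp only [hu', hv]
  rw [show -(s - 1) = -((s - 1) + 1) + 1 by ring, Complex.cpow_add _ _ (ofReal_ne_zero.2 hx0.ne'),
    Complex.cpow_one, show (s - 1) + 1 = s by ring]
  push_cast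
  field_simp

/-- **`∫_1^∞ P₁(x) x^{-s-1} dx = Λ̃(s−1)/s`** for `Re s > 2` (`Λ̃ = D − E`, the tree's `PiLi.lamTilde`,
"`log((u−1)ζ(u))` up to an entire function"; MNR: "`𝔐(Π_r)(s) = log ζ(s−r)/s + c/s`").
[cite: MassiasNicolasRobin1988, §5 proof of Lemme C] -/
theorem mellinIoi_pOne {s : ℂ} (hs : 2 < s.re) : mellinIoi pOne s = lamTilde (s - 1) / s := by
  have hP := integrable_ofReal_mul_cpow measurable_primePowerPi1 (σ₁ := (2 + s.re) / 2) (s := s)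
    (integrableOn_primePowerPi1_rpow (by linarith)) (by linarith)
  have hL := integrable_ofReal_mul_cpow measurable_liSq (σ₁ := (2 + s.re) / 2) (s := s)
    (integrableOn_liSq_rpow (by linarith)) (by linarith)
  unfold pOne lamTilde
  rw [mellinIoi_sub' hP hL, mellinIoi_primePowerPi1 hs, mellinIoi_liSq hs, PiOmega.mellinIoi_ell]
  field_simp

/-- **`∫_1^∞ P₁(x) log x · x^{-s-1} dx = −(d/ds)(Λ̃(s−1)/s) = −(ζ₁'/ζ₁(s−1) + q(s−1))/s + Λ̃(s−1)/s²`**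
for `Re s > 2` (differentiation under the integral sign; MNR: "`𝔐(log x · Π_r(x))(s) =
−(1/s) ζ'(s−r)/ζ(s−r) + log ζ(s−r)/s² + c/s²`"). [cite: MassiasNicolasRobin1988, §5 proof of Lemme C] -/
theorem mellinIoi_pOne_mul_log {s : ℂ} (hs : 2 < s.re) :
    mellinIoi (fun x ↦ pOne x * Real.log x) s =
      -(logDeriv riemannZeta₁ (s - 1) + qFn (s - 1)) / s + lamTilde (s - 1) / s ^ 2 := by
  have hs0 : s ≠ 0 := by rintro rfl; simp at hs; linarith
  rw [Nicolas.mellinIoi_mul_log measurable_pOne (σ₁ := (2 + s.re) / 2)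
    (integrableOn_pOne_rpow (by linarith)) (by linarith)]
  -- `mellinIoi P₁ = Λ̃(·−1)/·` near `s`
  have hEq : (fun z ↦ lamTilde (z - 1) / z) =ᶠ[𝓝 s] mellinIoi pOne := by
    filter_upwards [(isOpen_re_gt 2).mem_nhds hs] with z hz
    exact (mellinIoi_pOne hz).symm
  have hL : HasDerivAt (fun z ↦ lamTilde (z - 1)) (logDeriv riemannZeta₁ (s - 1) + qFn (s - 1)) s := by
    have h1 : HasDerivAt lamTilde (logDeriv riemannZeta₁ (s - 1) + qFn (s - 1)) (s - 1) :=
      hasDerivAt_lamTilde (by simp; linarith)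
    exact h1.comp_sub_const s 1
  have hD : HasDerivAt (fun z ↦ lamTilde (z - 1) / z)
      (((logDeriv riemannZeta₁ (s - 1) + qFn (s - 1)) * s - lamTilde (s - 1) * 1) / s ^ 2) s :=
    hL.div (hasDerivAt_id s) hs0
  rw [(hD.congr_of_eventuallyEq hEq.symm).deriv]
  field_simp
  ring

/-- The complex integrand of `x(ψ(x) − x)` is integrable on `(1,∞)` for `Re s > 2`. [folklore] -/
private theorem integrable_id_mul_psi_sub_cpow {s : ℂ} (hs : 2 < s.re) :
    Integrable (fun x : ℝ ↦ ((x * (ψ x - x) : ℝ) : ℂ) * (x : ℂ) ^ (-(s + 1)))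
      (volume.restrict (Ioi 1)) := by
  have hm : Measurable (fun x : ℝ ↦ x * (ψ x - x)) :=
    measurable_id.mul (Nicolas.measurable_psi.sub measurable_id)
  refine integrable_ofReal_mul_cpow (g := fun x : ℝ ↦ x * (ψ x - x)) hm
    (σ₁ := (2 + s.re) / 2) (s := s) ?_ (by linarith)
  refine integrableOn_rpow_of_abs_le_mul_rpow (g := fun x : ℝ ↦ x * (ψ x - x)) hm
    (C := 6) (a := 2) (fun x hx ↦ ?_) (by linarith)
  have hx0 : 0 < x := by linarith
  rw [abs_mul, abs_of_pos hx0, show (x ^ (2 : ℝ)) = x ^ 2 by norm_cast]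
  nlinarith [Nicolas.abs_psi_sub_self_le hx0.le, abs_nonneg (ψ x - x)]

/-- The complex integrand of `P₁(x) log x` is integrable on `(1,∞)` for `Re s > 2`. [folklore] -/
private theorem integrable_pOne_mul_log_cpow {s : ℂ} (hs : 2 < s.re) :
    Integrable (fun x : ℝ ↦ ((pOne x * Real.log x : ℝ) : ℂ) * (x : ℂ) ^ (-(s + 1)))
      (volume.restrict (Ioi 1)) := by
  refine integrable_ofReal_mul_cpow (measurable_pOne.mul Real.measurable_log)
    (σ₁ := (2 + s.re) / 2) (s := s) ?_ (by linarith)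
  exact Nicolas.integrableOn_mul_log_rpow measurable_pOne (σ₁ := (6 + s.re) / 4)
    (integrableOn_pOne_rpow (by linarith)) (by linarith)

/-- The complex integrand of `K` is integrable on `(1,∞)` for `Re s > 2`. [folklore] -/
private theorem integrable_mnrK_cpow {s : ℂ} (hs : 2 < s.re) :
    Integrable (fun x : ℝ ↦ ((mnrK x : ℝ) : ℂ) * (x : ℂ) ^ (-(s + 1))) (volume.restrict (Ioi 1)) := by
  refine ((integrable_id_mul_psi_sub_cpow hs).sub (integrable_pOne_mul_log_cpow hs)).congr
    (Eventually.of_forall fun x ↦ ?_)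
  simp only [mnrK, Pi.sub_apply]
  push_cast
  ring

/-- **The transform of `K`** on `Re s > 2`:
`∫_1^∞ K(x) x^{-s-1} dx = −(ζ₁'/ζ₁(s−1) + 1)/(s−1) + (ζ₁'/ζ₁(s−1) + q(s−1))/s − Λ̃(s−1)/s²`
(MNR's `𝔐(K)(s)`, `r = 1`: a simple pole at each `1 + ρ` and a logarithmic singularity behind it;
regular at `s = 2`). [cite: MassiasNicolasRobin1988, §5 proof of Lemme C (𝔐(K(x))(s))] -/
theorem mellinIoi_mnrK {s : ℂ} (hs : 2 < s.re) :
    mellinIoi mnrK s = -(logDeriv riemannZeta₁ (s - 1) + 1) / (s - 1) +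
      (logDeriv riemannZeta₁ (s - 1) + qFn (s - 1)) / s - lamTilde (s - 1) / s ^ 2 := by
  unfold mnrK
  rw [mellinIoi_sub' (integrable_id_mul_psi_sub_cpow hs) (integrable_pOne_mul_log_cpow hs),
    mellinIoi_id_mul_psi_sub hs, mellinIoi_pOne_mul_log hs]
  ring

/-- The comparison function `G(x) = c x^a − η K(x)` (`η = ±1`) of Landau's argument.
[cite: MassiasNicolasRobin1988, §5 proof of Lemme C ("le théorème de Landau")] -/
def cmp (c a η : ℝ) (x : ℝ) : ℝ := c * x ^ a - η * mnrK x

/-- Measurability of `G`. [folklore] -/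
private theorem measurable_cmp (c a η : ℝ) : Measurable (cmp c a η) :=
  (measurable_const.mul (measurable_id.pow_const _)).sub (measurable_const.mul measurable_mnrK)

/-- `|G(x)| ≤ (c + 8) x^{5/2}` on `(1, ∞)` for `c ≥ 0`, `a ≤ 5/2`, `|η| = 1`. [folklore] -/
private theorem abs_cmp_le {c a η : ℝ} (hc : 0 ≤ c) (ha : a ≤ 5 / 2) (hη : η = 1 ∨ η = -1) {x : ℝ}
    (hx : 1 < x) : |cmp c a η x| ≤ (c + 8) * x ^ (5 / 2 : ℝ) := by
  have hx0 : 0 < x := by linarith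
  have hηabs : |η| = 1 := by rcases hη with rfl | rfl <;> norm_num
  have h1 : x ^ a ≤ x ^ (5 / 2 : ℝ) := Real.rpow_le_rpow_of_exponent_le hx.le ha
  have h2 := abs_mnrK_le hx
  unfold cmp
  calc |c * x ^ a - η * mnrK x| ≤ |c * x ^ a| + |η * mnrK x| := abs_sub _ _
    _ = c * x ^ a + |mnrK x| := by
        rw [abs_mul, abs_mul, abs_of_nonneg hc, abs_of_pos (Real.rpow_pos_of_pos hx0 _), hηabs, one_mul]
    _ ≤ c * x ^ (5 / 2 : ℝ) + 8 * x ^ (5 / 2 : ℝ) := add_le_add (mul_le_mul_of_nonneg_left h1 hc) h2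
    _ = (c + 8) * x ^ (5 / 2 : ℝ) := by ring

/-- **The transform of `G`** on `Re s > 2`, `a < Re s`:
`c/(s−a) − η(−(ζ₁'/ζ₁(s−1) + 1)/(s−1) + (ζ₁'/ζ₁(s−1) + q(s−1))/s − Λ̃(s−1)/s²)`.
[cite: MassiasNicolasRobin1988, §5 proof of Lemme C] -/
theorem mellinIoi_cmp {c a η : ℝ} {s : ℂ} (ha : a < s.re) (hs : 2 < s.re) :
    mellinIoi (cmp c a η) s = c / (s - a) - η * (-(logDeriv riemannZeta₁ (s - 1) + 1) / (s - 1) +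
      (logDeriv riemannZeta₁ (s - 1) + qFn (s - 1)) / s - lamTilde (s - 1) / s ^ 2) := by
  have hIk : Integrable (fun x : ℝ ↦ ((c * x ^ a : ℝ) : ℂ) * (x : ℂ) ^ (-(s + 1)))
      (volume.restrict (Ioi 1)) := by
    have h := integrable_ofReal_mul_cpow (g := fun x : ℝ ↦ x ^ a) (measurable_id.pow_const _)
      (σ₁ := (a + s.re) / 2) (s := s) (PsiOmega.integrableOn_rpow_rpow (by linarith)) (by linarith)
    have := h.const_mul (c : ℂ)
    refine this.congr (Eventually.of_forall fun x ↦ ?_)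
    push_cast; ring
  have hIK : Integrable (fun x : ℝ ↦ ((η * mnrK x : ℝ) : ℂ) * (x : ℂ) ^ (-(s + 1)))
      (volume.restrict (Ioi 1)) := by
    have := (integrable_mnrK_cpow hs).const_mul (η : ℂ)
    refine this.congr (Eventually.of_forall fun x ↦ ?_)
    push_cast; ring
  unfold cmp
  rw [mellinIoi_sub' hIk hIK, mellinIoi_const_mul, mellinIoi_const_mul, mellinIoi_mnrK hs,
    PsiOmega.mellinIoi_rpow ha]
  field_simp


/-! ### MNR's Lemma C (i) (`r = 1`) at a zero: `K(x) = Ω±(x^{1+b})` for every `b < Re ρ₀` -/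

/-- A half-plane `{Re s > a}` has no holes (leftward rays), the hypothesis of the tree's
`Complex.isExactOn_of_compl`. [folklore] -/
private theorem not_isBounded_connectedComponentIn_compl_halfPlane (a : ℝ) (z : ℂ)
    (hz : z ∈ {s : ℂ | a < s.re}ᶜ) : ¬ Bornology.IsBounded (connectedComponentIn {s : ℂ | a < s.re}ᶜ z) := by
  refine not_isBounded_connectedComponentIn_of_ray (neg_ne_zero.2 one_ne_zero) fun t ht ↦ ?_
  have hz' : ¬ a < z.re := hz
  show ¬ a < (z + t * -1).re
  have : (z + t * -1).re = z.re - t := by simp [sub_eq_add_neg]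
  rw [this]; linarith

/-- **Core step (MNR Lemma C (i), `r = 1`, at a zero; Landau's theorem).** Let `ρ₀` be a zero of `ζ`
with `Re ρ₀ > b > 0`, `η = ±1`, `c > 0`. Then `η K(x) ≤ c x^{1+b}` cannot hold for all large `x`.
Otherwise `G = c x^{1+b} − ηK ≥ 0` beyond `X₀`; its transform `c/(s−1−b) − η 𝔐(K)(s)` continues
holomorphically along the real axis down to `1 + b` (the strip about the real ray carries no zero of
`ζ₁(s−1)`, and `Λ̃(s−1)` has a primitive continuation there), so by Landau's lemma
`F = ∫ G x^{-s-1}` is holomorphic on `H = {Re s > 1+b} ∋ 1 + ρ₀`. On `Re s > 3`,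
`R := η(c/(s−a) − F) − (q(s−1) − 1)/(s−1) = −Λ̃'(s−1)/(s(s−1)) − Λ̃(s−1)/s²`, i.e.
`(e^s Λ̃(s−1)/s)' = −e^s(s−1)R(s)`; integrating the right-hand side over the (hole-free) half-plane
`H` continues `Λ̃(s−1)`, hence `ζ₁'/ζ₁(s−1) = Λ̃'(s−1) − q(s−1)`, holomorphically to `H`, and a
holomorphic logarithmic derivative of `ζ₁(s−1)` on `H` is incompatible with the zero at `1 + ρ₀`
(`PsiOmega.eq_zero_of_deriv_eq_mul`, `ζ₁(1) = 1`). MNR phrase this as "la singularité dominante est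
un pôle donc `K(x) = Ω±(x^{θ+r})`"; run strictly inside (`b < Re ρ₀`) no local analysis at the pole
is needed. [cite: MassiasNicolasRobin1988, §5 Lemme C (i) and its proof; MontgomeryVaughan2007, §15.1 Lemma 15.1] -/
theorem false_of_eventually_le {ρ₀ : ℂ} (h0 : riemannZeta ρ₀ = 0) {b : ℝ} (hb0 : 0 < b)
    (hbρ : b < ρ₀.re) {c η : ℝ} (hη : η = 1 ∨ η = -1) (hc0 : 0 < c)
    (hev : ∀ᶠ x in atTop, η * mnrK x ≤ c * x ^ (1 + b)) : False := by
  -- (1) the zero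
  have hre : 0 < ρ₀.re := hb0.trans hbρ
  have hρre1 : ρ₀.re < 1 := by
    by_contra h
    exact riemannZeta_ne_zero_of_one_le_re (not_lt.1 h) h0
  have hb1 : b < 1 := hbρ.trans hρre1
  have hγ : ρ₀.im ≠ 0 := im_ne_zero_of_riemannZeta_eq_zero h0 hre hρre1
  have hρ1 : ρ₀ ≠ 1 := by intro h; apply hγ; rw [h]; simp
  have hζ₁0 : riemannZeta₁ ρ₀ = 0 := (riemannZeta₁_eq_zero_iff hρ1).2 h0
  have hηsq : (η : ℂ) * η = 1 := by rcases hη with rfl | rfl <;> push_cast <;> norm_num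
  obtain ⟨δ, hδ, -, hgap⟩ := ZetaZeroSum.exists_gap_im
  set a : ℝ := 1 + b with ha_def
  have ha1 : 1 < a := by rw [ha_def]; linarith
  have ha2 : a < 2 := by rw [ha_def]; linarith
  -- (2) the non-negative function `G`
  obtain ⟨X₁, hX₁⟩ := eventually_atTop.1 hev
  set X₀ : ℝ := max X₁ 1 with hX₀def
  have hX₀ : 1 ≤ X₀ := le_max_right _ _
  set G : ℝ → ℝ := cmp c a η with hGdef
  have hGm : Measurable G := measurable_cmp c a η
  have hpos : ∀ x, X₀ < x → 0 ≤ G x := fun x hx ↦ by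
    have := hX₁ x ((le_max_left _ _).trans hx.le)
    simp only [hGdef, cmp, ha_def]
    linarith
  have hGbs : ∀ x, 1 < x → |G x| ≤ (c + 8) * x ^ (5 / 2 : ℝ) := fun x hx ↦
    abs_cmp_le hc0.le (by rw [ha_def]; linarith) hη hx
  have hint : IntegrableOn (fun x ↦ G x * x ^ (-((3 : ℝ) + 1))) (Ioi 1) :=
    integrableOn_rpow_of_abs_le_mul_rpow hGm hGbs (by norm_num)
  -- (3) the primitive `Lam` of `ζ₁'/ζ₁ + q` on `U = region (b/2) δ`, and `W₀ = strip a δ` (`W₀ − 1 ⊆ U`)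
  obtain ⟨Lam, hLam, hLamEq⟩ :=
    exists_primitive_on_region (a := b / 2) (δ := δ) (by linarith) (by linarith) hδ hgap
  set W₀ : Set ℂ := strip a δ with hW₀
  have hW₀r : ∀ σ' : ℝ, a < σ' → σ' ≤ 3 + 1 → (σ' : ℂ) ∈ W₀ := by
    intro σ' h1 _
    refine ⟨by simpa using h1, ?_, ?_⟩
    · show -(2 * δ) < ((σ' : ℝ) : ℂ).im
      rw [ofReal_im]; linarith
    · show ((σ' : ℝ) : ℂ).im < 2 * δ
      rw [ofReal_im]; linarith
  have hmem : ∀ s ∈ ({s : ℂ | (3 : ℝ) < s.re} ∪ W₀), a < s.re ∧ (s - 1) ∈ region (b / 2) δ := by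
    rintro s (hs | hs)
    · have hs' : (3 : ℝ) < s.re := hs
      refine ⟨by linarith, Or.inl ?_⟩
      show (1 : ℝ) < (s - 1).re
      simp; linarith
    · refine ⟨hs.1, Or.inr ⟨?_, ?_, ?_⟩⟩
      · show b / 2 < (s - 1).re
        have := hs.1; simp; rw [ha_def] at this; linarith
      · show -(2 * δ) < (s - 1).im
        simp; exact hs.2.1
      · show (s - 1).im < 2 * δ
        simp; exact hs.2.2
  set Φ : ℂ → ℂ := fun s ↦ c / (s - a) - η * (-(logDeriv riemannZeta₁ (s - 1) + 1) / (s - 1) +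
      (logDeriv riemannZeta₁ (s - 1) + qFn (s - 1)) / s - Lam (s - 1) / s ^ 2) with hΦ
  have hΦd : DifferentiableOn ℂ Φ ({s : ℂ | (3 : ℝ) < s.re} ∪ W₀) := by
    intro s hs
    obtain ⟨has, hsU⟩ := hmem s hs
    have hs0 : s ≠ 0 := by intro h; rw [h] at has; simp at has; linarith
    have hs1 : s ≠ 1 := by intro h; rw [h] at has; simp at has; linarith
    have hsa : s ≠ (a : ℂ) := by intro h; rw [h] at has; simp at has
    have hζ : riemannZeta₁ (s - 1) ≠ 0 :=
      riemannZeta₁_ne_zero_of_mem_region (a := b / 2) (by linarith) hgap hsU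
    have dsh : DifferentiableAt ℂ (fun z : ℂ ↦ z - 1) s := differentiableAt_id.sub_const 1
    have dLD : DifferentiableAt ℂ (fun z : ℂ ↦ logDeriv riemannZeta₁ (z - 1)) s :=
      (PsiOneExplicit.analyticAt_logDeriv_riemannZeta₁ hζ).differentiableAt.comp s dsh
    have dq : DifferentiableAt ℂ (fun z : ℂ ↦ qFn (z - 1)) s := (differentiable_qFn _).comp s dsh
    have dL : DifferentiableAt ℂ (fun z : ℂ ↦ Lam (z - 1)) s :=
      (hLam (s - 1) hsU).differentiableAt.comp s dsh
    have d0 : DifferentiableAt ℂ (fun z : ℂ ↦ (c : ℂ) / (z - a)) s :=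
      (differentiableAt_const _).div (differentiableAt_id.sub_const _) (sub_ne_zero.2 hsa)
    have d1 : DifferentiableAt ℂ (fun z : ℂ ↦ -(logDeriv riemannZeta₁ (z - 1) + 1) / (z - 1)) s :=
      (dLD.add_const _).neg.div dsh (sub_ne_zero.2 hs1)
    have d2 : DifferentiableAt ℂ (fun z : ℂ ↦ (logDeriv riemannZeta₁ (z - 1) + qFn (z - 1)) / z) s :=
      (dLD.add dq).div differentiableAt_id hs0
    have d3 : DifferentiableAt ℂ (fun z : ℂ ↦ Lam (z - 1) / z ^ 2) s :=
      dL.div (differentiableAt_id.pow 2) (pow_ne_zero 2 hs0)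
    exact (d0.sub (((d1.add d2).sub d3).const_mul _)).differentiableWithinAt
  have hagree : EqOn Φ (mellinIoi G) {s : ℂ | (3 : ℝ) < s.re} := by
    intro s hs
    have hs' : (3 : ℝ) < s.re := hs
    rw [hGdef, mellinIoi_cmp (by linarith) (by linarith)]
    simp only [hΦ]
    rw [hLamEq (show (1 : ℝ) < (s - 1).re by simp; linarith)]
  -- (4) Landau's lemma: absolute convergence on `Re s > a`, so `F` is holomorphic on `H = {Re s > a}`
  have hI : ∀ σ : ℝ, a < σ → IntegrableOn (fun x ↦ G x * x ^ (-(σ + 1))) (Ioi 1) := fun σ hσ ↦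
    Landau.integrableOn_of_differentiableOn_union_convex hGm hint hX₀ hpos (by linarith : a < 3)
      (isOpen_strip a δ) (convex_strip a δ) hW₀r hΦd hagree hσ
  set F : ℂ → ℂ := mellinIoi G with hFdef
  set H : Set ℂ := {s : ℂ | a < s.re} with hHdef
  have hHo : IsOpen H := isOpen_re_gt a
  have hFd : DifferentiableOn ℂ F H := differentiableOn_mellinIoi_of_forall hGm hI
  have hFdec : ∀ s : ℂ, 2 < s.re → F s = c / (s - a) - η * (-(logDeriv riemannZeta₁ (s - 1) + 1) / (s - 1) +
      (logDeriv riemannZeta₁ (s - 1) + qFn (s - 1)) / s - lamTilde (s - 1) / s ^ 2) := fun s hs ↦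
    mellinIoi_cmp (by linarith) (by linarith)
  -- (5) `R = η(c/(s−a) − F) − (q(s−1) − 1)/(s−1)`, holomorphic on `H`,
  --     `= −Λ̃'(s−1)/(s(s−1)) − Λ̃(s−1)/s²` on `Re s > 2`
  set R : ℂ → ℂ := fun s ↦ η * (c / (s - a) - F s) - (qFn (s - 1) - 1) / (s - 1) with hRdef
  have hRd : DifferentiableOn ℂ R H := by
    intro s hs
    have has : a < s.re := hs
    have hs1 : s ≠ 1 := by intro h; rw [h] at has; simp at has; linarith
    have hsa : s ≠ (a : ℂ) := by intro h; rw [h] at has; simp at has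
    have dsh : DifferentiableAt ℂ (fun z : ℂ ↦ z - 1) s := differentiableAt_id.sub_const 1
    have d0 : DifferentiableAt ℂ (fun z : ℂ ↦ (c : ℂ) / (z - a)) s :=
      (differentiableAt_const _).div (differentiableAt_id.sub_const _) (sub_ne_zero.2 hsa)
    have dF : DifferentiableAt ℂ F s := (hFd s hs).differentiableAt (hHo.mem_nhds has)
    have dq : DifferentiableAt ℂ (fun z : ℂ ↦ (qFn (z - 1) - 1) / (z - 1)) s :=
      (((differentiable_qFn _).comp s dsh).sub_const _).div dsh (sub_ne_zero.2 hs1)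
    exact (((d0.sub dF).const_mul _).sub dq).differentiableWithinAt
  have hRV : ∀ s : ℂ, 2 < s.re → R s = -(logDeriv riemannZeta₁ (s - 1) + qFn (s - 1)) / (s * (s - 1)) -
      lamTilde (s - 1) / s ^ 2 := by
    intro s hs
    have hs0 : s ≠ 0 := by rintro rfl; simp at hs; linarith
    have hs1 : s - 1 ≠ 0 := by
      intro h; have := congrArg Complex.re h; simp at this; linarith
    simp only [hRdef, hFdec s hs]
    field_simp
    linear_combination (-(s * (logDeriv riemannZeta₁ (s - 1) + 1)) * s +
      (logDeriv riemannZeta₁ (s - 1) + qFn (s - 1)) * (s - 1) * s - lamTilde (s - 1) * (s - 1)) * hηsq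
  -- (6) `φ = −e^s(s−1)R` has a primitive `Ψ` on the hole-free half-plane `H`; normalise at `3`
  set φ : ℂ → ℂ := fun s ↦ -(Complex.exp s * (s - 1) * R s) with hφdef
  have hφd : DifferentiableOn ℂ φ H := fun s hs ↦
    ((differentiable_exp s).differentiableWithinAt.mul (differentiableWithinAt_id.sub_const _)).mul
      (hRd s hs) |>.neg
  obtain ⟨Ψ₀, hΨ₀⟩ := Complex.isExactOn_of_compl hHo (convex_halfSpace_re_gt a).isPreconnected
    (not_isBounded_connectedComponentIn_compl_halfPlane a) hφd
  set Ψ : ℂ → ℂ := fun s ↦ Ψ₀ s - Ψ₀ 3 + Complex.exp 3 / 3 * lamTilde 2 with hΨdef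
  have hΨ : ∀ s ∈ H, HasDerivAt Ψ (φ s) s := fun s hs ↦ ((hΨ₀ s hs).sub_const _).add_const _
  have h3H : (3 : ℂ) ∈ H := by show a < (3 : ℂ).re; norm_num; linarith
  set V : Set ℂ := {s : ℂ | (2 : ℝ) < s.re} with hVdef
  have hVo : IsOpen V := isOpen_re_gt 2
  have hVH : V ⊆ H := fun s hs ↦ by
    have : (2 : ℝ) < s.re := hs
    show a < s.re; linarith
  have h3V : (3 : ℂ) ∈ V := by show (2 : ℝ) < (3 : ℂ).re; norm_num
  -- `D(s) = e^s Λ̃(s−1)/s − Ψ(s)` is constant (`= 0`) on `V`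
  set D : ℂ → ℂ := fun s ↦ Complex.exp s / s * lamTilde (s - 1) - Ψ s with hDdef
  have hDderiv : ∀ s ∈ V, HasDerivAt D 0 s := by
    intro s hs
    have hs' : (2 : ℝ) < s.re := hs
    have hs0 : s ≠ 0 := by rintro rfl; simp at hs'; linarith
    have hs1 : s - 1 ≠ 0 := by
      intro h; have := congrArg Complex.re h; simp at this; linarith
    have d1 : HasDerivAt (fun z : ℂ ↦ Complex.exp z / z)
        ((Complex.exp s * s - Complex.exp s * 1) / s ^ 2) s :=
      (Complex.hasDerivAt_exp s).div (hasDerivAt_id s) hs0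
    have d2 : HasDerivAt (fun z : ℂ ↦ lamTilde (z - 1))
        (logDeriv riemannZeta₁ (s - 1) + qFn (s - 1)) s :=
      (hasDerivAt_lamTilde (by simp; linarith)).comp_sub_const s 1
    have d3 := ((d1.mul d2).sub (hΨ s (hVH hs)))
    have hval : (Complex.exp s * s - Complex.exp s * 1) / s ^ 2 * lamTilde (s - 1) +
        Complex.exp s / s * (logDeriv riemannZeta₁ (s - 1) + qFn (s - 1)) - φ s = 0 := by
      simp only [hφdef, hRV s hs']
      field_simp
      ring
    rw [hval] at d3
    exact d3
  have hD3 : D 3 = 0 := by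
    simp only [hDdef, hΨdef, sub_self, zero_add]
    norm_num
  have hDV : ∀ s ∈ V, D s = 0 := fun s hs ↦ by
    rw [← hD3]
    exact hVo.is_const_of_deriv_eq_zero (convex_halfSpace_re_gt 2).isPreconnected
      (fun w hw ↦ (hDderiv w hw).differentiableAt.differentiableWithinAt)
      (fun w hw ↦ (hDderiv w hw).deriv) hs h3V
  -- (7) `W = s e^{-s} Ψ` continues `Λ̃(s−1)` to `H`; `ζ₁(s−1)' = (W' − q(s−1)) ζ₁(s−1)` on `H`
  set Wf : ℂ → ℂ := fun s ↦ s / Complex.exp s * Ψ s with hWdef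
  have hWd : DifferentiableOn ℂ Wf H := fun s hs ↦
    ((differentiableWithinAt_id.div (differentiable_exp s).differentiableWithinAt (Complex.exp_ne_zero s))).mul
      (hΨ s hs).differentiableAt.differentiableWithinAt
  have hWV : ∀ s ∈ V, Wf s = lamTilde (s - 1) := by
    intro s hs
    have hs' : (2 : ℝ) < s.re := hs
    have hs0 : s ≠ 0 := by rintro rfl; simp at hs'; linarith
    have h := hDV s hs
    simp only [hDdef, sub_eq_zero] at h
    simp only [hWdef, ← h]
    field_simp
  set af : ℂ → ℂ := fun s ↦ deriv Wf s - qFn (s - 1) with hafdef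
  have hafd : DifferentiableOn ℂ af H := by
    have h1 : DifferentiableOn ℂ (deriv Wf) H := (hWd.analyticOnNhd hHo).deriv.differentiableOn
    exact h1.sub ((differentiable_qFn.comp (differentiable_id.sub_const 1)).differentiableOn)
  set f : ℂ → ℂ := fun s ↦ riemannZeta₁ (s - 1) with hfdef
  have hf : Differentiable ℂ f := differentiable_riemannZeta₁.comp (differentiable_id.sub_const 1)
  have hODEV : ∀ s ∈ V, deriv f s = af s * f s := by
    intro s hs
    have hs' : (2 : ℝ) < s.re := hs
    have hζ : riemannZeta₁ (s - 1) ≠ 0 := by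
      have hs2 : s - 1 ≠ 1 := by
        intro h; have := congrArg Complex.re h; simp at this; linarith
      rw [Ne, riemannZeta₁_eq_zero_iff hs2]
      exact riemannZeta_ne_zero_of_one_lt_re (by simp; linarith)
    -- `W' = Λ̃'(s−1)` on `V`
    have hWderiv : deriv Wf s = logDeriv riemannZeta₁ (s - 1) + qFn (s - 1) := by
      have d2 : HasDerivAt (fun z : ℂ ↦ lamTilde (z - 1))
          (logDeriv riemannZeta₁ (s - 1) + qFn (s - 1)) s :=
        (hasDerivAt_lamTilde (by simp; linarith)).comp_sub_const s 1
      have hEq : (fun z : ℂ ↦ lamTilde (z - 1)) =ᶠ[𝓝 s] Wf := by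
        filter_upwards [hVo.mem_nhds hs] with z hz using (hWV z hz).symm
      exact (d2.congr_of_eventuallyEq hEq.symm).deriv
    have hfderiv : deriv f s = deriv riemannZeta₁ (s - 1) :=
      ((differentiable_riemannZeta₁ _).hasDerivAt.comp_sub_const s 1).deriv
    rw [hfderiv]
    simp only [hafdef, hWderiv, hfdef, add_sub_cancel_right, logDeriv_apply, div_mul_cancel₀ _ hζ]
  have hODE : EqOn (deriv f) (fun s ↦ af s * f s) H := by
    set E : ℂ → ℂ := fun s ↦ deriv f s - af s * f s with hE
    have hEd : DifferentiableOn ℂ E H := by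
      intro s hs
      exact ((hf.analyticAt s).deriv.differentiableAt.differentiableWithinAt).sub
        ((hafd s hs).mul (hf s).differentiableWithinAt)
    have hEa : AnalyticOnNhd ℂ E H := hEd.analyticOnNhd hHo
    have hev' : E =ᶠ[𝓝 (3 : ℂ)] 0 := by
      filter_upwards [hVo.mem_nhds h3V] with s hs
      simp only [hE, Pi.zero_apply, hODEV s hs, sub_self]
    have hz := hEa.eqOn_zero_of_preconnected_of_eventuallyEq_zero
      (convex_halfSpace_re_gt a).isPreconnected h3H hev'
    intro s hs
    have := hz hs
    simp only [hE, Pi.zero_apply, sub_eq_zero] at this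
    exact this
  -- (8) the zero `1 + ρ₀ ∈ H` of `f` propagates: `f ≡ 0`, but `f(2) = ζ₁(1) = 1`
  have hρH : (1 + ρ₀) ∈ H := by show a < (1 + ρ₀).re; simp; rw [ha_def]; linarith
  have hf0 : f (1 + ρ₀) = 0 := by simp only [hfdef, add_sub_cancel_left, hζ₁0]
  have hzero := PsiOmega.eq_zero_of_deriv_eq_mul hf hHo hafd hODE hρH hf0
  have h2 := congrFun hzero 2
  simp only [hfdef, Pi.zero_apply] at h2
  norm_num [riemannZeta₁_one] at h2

/-- **Massias–Nicolas–Robin 1988, Lemma C (i) (`r = 1`) at a zero, sign form.** For every zero `ρ₀`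
of `ζ`, every `0 < b < Re ρ₀` and every `c > 0`: `K(x) ≥ c x^{1+b}` for arbitrarily large `x` and
`K(x) ≤ −c x^{1+b}` for arbitrarily large `x`, where
`K(x) = x(ψ(x) − x) − (Π₁(x) − li(x²) + li 4) log x` (MNR: "`Π_r(x) = Li(x^{r+1}) + (x^r/log x)(ψ(x) − x) + Ω±(x^{ξ+r})`
pour `ξ < θ`"). [cite: MassiasNicolasRobin1988, §5 Lemme C (i)] -/
theorem frequently_le_mnrK_and_mnrK_le {ρ₀ : ℂ} (h0 : riemannZeta ρ₀ = 0) {b : ℝ} (hb0 : 0 < b)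
    (hbρ : b < ρ₀.re) {c : ℝ} (hc0 : 0 < c) :
    (∃ᶠ x in atTop, c * x ^ (1 + b) ≤ mnrK x) ∧ (∃ᶠ x in atTop, mnrK x ≤ -(c * x ^ (1 + b))) := by
  constructor
  · by_contra h
    refine false_of_eventually_le h0 hb0 hbρ (Or.inl rfl) hc0 ?_
    filter_upwards [not_frequently.1 h] with x hx
    rw [one_mul]
    exact (not_le.1 hx).le
  · by_contra h
    refine false_of_eventually_le h0 hb0 hbρ (Or.inr rfl) hc0 ?_
    filter_upwards [not_frequently.1 h] with x hx
    have := not_le.1 hx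
    linarith


/-! ### Landau's function at `n = ∑_{p ≤ N} p`: `g(n) ≥ N#`, so `log g(n) ≥ θ(N)` -/

/-- `π₁(N) = ∑_{p ≤ N} p`, the sum of the primes up to `N`, as a natural number (MNR's `π_r(x)`,
`r = 1`; it is `ℓ(N#)` for the additive function `ℓ` of MNR §4). [cite: MassiasNicolasRobin1988, §2 (notation π_r) and §4 Définition 1] -/
def primeSum (N : ℕ) : ℕ := ∑ p ∈ Nat.primesLE N, p

/-- **`N# ≤ g(∑_{p ≤ N} p)`**: the permutation of `∑_{p≤N} p` letters with one `p`-cycle for each prime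
`p ≤ N` has order `∏_{p ≤ N} p = N#` (MNR §4: `g(n) = max_{ℓ(k) ≤ n} k`, and `ℓ(N#) = ∑_{p≤N} p`).
[cite: MassiasNicolasRobin1988, §4 (Définition 1 and "g(n) = max k")] -/
theorem primorial_le_landauFn_primeSum (N : ℕ) : primorial N ≤ landauFn (primeSum N) := by
  classical
  have hex : ∃ g : Equiv.Perm (Fin (primeSum N)), g.cycleType = (Nat.primesLE N).val := by
    rw [Equiv.Perm.exists_with_cycleType_iff]
    refine ⟨?_, fun a ha ↦ (Nat.prime_of_mem_primesLE (Finset.mem_def.2 ha)).two_le⟩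
    rw [Fintype.card_fin, primeSum, Finset.sum_eq_multiset_sum, Multiset.map_id']
  obtain ⟨g, hg⟩ := hex
  have hdvd : primorial N ∣ orderOf g := by
    rw [primorial_eq_prod_primesLE]
    refine Finset.prod_primes_dvd (orderOf g) (fun p hp ↦ (Nat.prime_of_mem_primesLE hp).prime)
      fun p hp ↦ Equiv.Perm.dvd_of_mem_cycleType ?_
    rw [hg]
    exact Finset.mem_def.1 hp
  exact (Nat.le_of_dvd (orderOf_pos g) hdvd).trans (orderOf_le_landauFn g)

/-- Hence **`θ(x) ≤ log g(∑_{p ≤ x} p)`** (`θ(x) = log ⌊x⌋#`). [cite: MassiasNicolasRobin1988, §4 (6) ("θ(x₁) ≤ log N_ρ")] -/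
theorem theta_le_log_landauFn_primeSum (x : ℝ) :
    θ x ≤ Real.log (landauFn (primeSum ⌊x⌋₊)) := by
  rw [Chebyshev.theta_eq_log_primorial]
  exact Real.log_le_log (by exact_mod_cast primorial_pos _)
    (by exact_mod_cast primorial_le_landauFn_primeSum _)

/-- `∑_{p ≤ x} p ≤ Π₁(x)` (the primes are among the prime powers, with weight `p`). [cite: MassiasNicolasRobin1988, §5 Lemme B (proof: "Π_r(x) = π_r(x) + ½ π_{2r}(x^{1/2}) + …")] -/
theorem primeSum_le_primePowerPi1 (x : ℝ) : (primeSum ⌊x⌋₊ : ℝ) ≤ primePowerPi1 x := by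
  unfold primeSum primePowerPi1
  push_cast
  have hsub : Nat.primesLE ⌊x⌋₊ ⊆ Finset.Ioc 0 ⌊x⌋₊ := by
    intro p hp
    rw [Nat.mem_primesLE] at hp
    exact Finset.mem_Ioc.2 ⟨hp.2.pos, hp.1⟩
  have heq : ∀ p ∈ Nat.primesLE ⌊x⌋₊, (p : ℝ) = Λ p * (p : ℝ) / Real.log p := by
    intro p hp
    have hp' := Nat.prime_of_mem_primesLE hp
    rw [vonMangoldt_apply_prime hp']
    have : Real.log p ≠ 0 := (Real.log_pos (by exact_mod_cast hp'.one_lt)).ne'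
    field_simp
  rw [Finset.sum_congr rfl heq]
  exact Finset.sum_le_sum_of_subset_of_nonneg hsub fun n _ _ ↦
    div_nonneg (mul_nonneg vonMangoldt_nonneg (Nat.cast_nonneg n)) (Real.log_natCast_nonneg n)

/-- `∑_{p ≤ N} p → ∞`. [folklore] -/
private theorem tendsto_primeSum_atTop : Tendsto primeSum atTop atTop := by
  refine tendsto_atTop_atTop.2 fun M ↦ ?_
  obtain ⟨p, hMp, hp⟩ := Nat.exists_infinite_primes M
  refine ⟨p, fun N hN ↦ hMp.trans ?_⟩
  have hmem : p ∈ Nat.primesLE N := Nat.mem_primesLE.2 ⟨hN, hp⟩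
  exact Finset.single_le_sum (f := fun q ↦ q) (fun q _ ↦ Nat.zero_le q) hmem

/-! ### Convexity of `t ↦ li(t²)`: `li(y²) − li(x²) ≥ (y − x) x/log x` -/

/-- `x/log x ≤ c/log c` for `e ≤ x ≤ c` (`log t/t` is decreasing on `[e, ∞)`). [folklore] -/
private theorem div_log_mono {x c : ℝ} (hx : Real.exp 1 ≤ x) (hxc : x ≤ c) :
    x / Real.log x ≤ c / Real.log c := by
  have hx0 : 0 < x := (Real.exp_pos 1).trans_le hx
  have hc0 : 0 < c := hx0.trans_le hxc
  have hlx : 0 < Real.log x := Real.log_pos (lt_of_lt_of_le (by have := Real.exp_one_gt_d9; linarith) hx)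
  have hlc : 0 < Real.log c := Real.log_pos (lt_of_lt_of_le (by have := Real.exp_one_gt_d9; linarith) (hx.trans hxc))
  have h := Real.log_div_self_antitoneOn hx (hx.trans hxc) hxc
  rw [div_le_div_iff₀ hlx hlc]
  rw [div_le_div_iff₀ hc0 hx0] at h
  linarith

/-- **The tangent-line inequality for the convex function `t ↦ li(t²)`** (MNR §6: "la convexité de
la fonction `t → Li(t²)` donne `Li(ψ²(x₁)) ≥ Li(x₁²) + (x₁/log x₁)(ψ(x₁) − x₁)`"): for `x, y ≥ e`,
`J(y) − J(x) ≥ (y − x) · x/log x`. [cite: MassiasNicolasRobin1988, §6 (convexity of t ↦ Li(t²))] -/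
theorem mul_div_log_le_liSq_sub {x y : ℝ} (hx : Real.exp 1 ≤ x) (hy : Real.exp 1 ≤ y) :
    (y - x) * (x / Real.log x) ≤ liSq y - liSq x := by
  have he2 : (2 : ℝ) < Real.exp 1 := by have := Real.exp_one_gt_d9; linarith
  rcases lt_trichotomy x y with hxy | rfl | hyx
  · obtain ⟨c, hc, hc'⟩ := exists_hasDerivAt_eq_slope liSq (fun t ↦ t / Real.log t) hxy
      continuous_liSq.continuousOn (fun t ht ↦ hasDerivAt_liSq (by linarith [ht.1]))
    have h1 : x / Real.log x ≤ c / Real.log c := div_log_mono hx hc.1.le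
    have h2 : c / Real.log c * (y - x) = liSq y - liSq x := by
      rw [hc', div_mul_cancel₀ _ (sub_ne_zero.2 hxy.ne')]
    nlinarith
  · simp
  · obtain ⟨c, hc, hc'⟩ := exists_hasDerivAt_eq_slope liSq (fun t ↦ t / Real.log t) hyx
      continuous_liSq.continuousOn (fun t ht ↦ hasDerivAt_liSq (by linarith [ht.1]))
    have h1 : c / Real.log c ≤ x / Real.log x := div_log_mono (hy.trans hc.1.le) hc.2.le
    have h2 : c / Real.log c * (x - y) = liSq x - liSq y := by
      rw [hc', div_mul_cancel₀ _ (sub_ne_zero.2 hyx.ne')]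
    nlinarith

/-! ### `li`: the bridge `li(t²) = J(t) + li(4)`, `li(4) > 0`, and `li` takes every value `≥ 2` on `(1, ∞)` -/

/-- `li(t²) = J(t) + li(4)` for `t ≥ 2` (`li x − li 2 = Li x`). [cite: AbramowitzStegun1964, 5.1.3] -/
theorem logIntegral_sq_eq {t : ℝ} (ht : 2 ≤ t) : logIntegral (t ^ 2) = liSq t + logIntegral 4 := by
  rw [liSq_of_two_le ht, logIntegral_eq_offsetLogIntegral_add_logIntegral_two (by nlinarith),
    logIntegral_eq_offsetLogIntegral_add_logIntegral_two (by norm_num : (1:ℝ) < 4)]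
  ring

/-- `li(4) > 0` (`Li(4) ≥ 0`, `li(2) > 0`). [cite: AbramowitzStegun1964, 5.1.3] -/
theorem logIntegral_four_pos : 0 < logIntegral 4 := by
  rw [logIntegral_eq_offsetLogIntegral_add_logIntegral_two (by norm_num : (1:ℝ) < 4)]
  have h1 : 0 ≤ offsetLogIntegral 4 := by
    have := offsetLogIntegralPow_nonneg 1 (x := 4) (by norm_num)
    rwa [offsetLogIntegralPow_one] at this
  have h2 : 0 < logIntegral 2 := logIntegral_two_pos_holds
  linarith

/-- `li(2) ≤ 2` (from Ramanujan's series `li 2 = γ + log log 2 + log 2 + R`, `0 ≤ R ≤ (log 2)²/2`;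
numerically `li 2 = 1.045…`). [cite: AbramowitzStegun1964, 5.1.10 and Table 5.1] -/
theorem logIntegral_two_le_two : logIntegral 2 ≤ 2 := by
  have h := (SchoenfeldNumerics.logIntegral_mem_Icc (x := 2) one_lt_two 1).2
  simp only [Finset.sum_range_one, logIntegralSeriesTerm, zero_add, pow_one, Nat.factorial,
    Nat.cast_one, mul_one] at h
  have hl2 := Real.log_two_lt_d9
  have hl2' := Real.log_two_gt_d9
  have hγ := Real.eulerMascheroniConstant_lt_two_thirds
  have hll : Real.log (Real.log 2) ≤ Real.log 2 - 1 := Real.log_le_sub_one_of_pos (by linarith)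
  norm_num at h
  nlinarith

/-- `li` takes every value `t ≥ 2` at some point `y ≥ 2` (`li` is continuous and increasing on
`(1, ∞)`, `li(2) ≤ 2`, `li → ∞`). [cite: AbramowitzStegun1964, 5.1.3] -/
theorem exists_logIntegral_eq {t : ℝ} (ht : 2 ≤ t) : ∃ y : ℝ, 2 ≤ y ∧ logIntegral y = t := by
  have hT : Tendsto offsetLogIntegral atTop atTop := by
    have := tendsto_offsetLogIntegralPow_atTop 1
    rwa [offsetLogIntegralPow_one] at this
  obtain ⟨Y, hY⟩ := ((hT.eventually_ge_atTop t).and (eventually_ge_atTop 2)).exists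
  have hli2 : 0 < logIntegral 2 := logIntegral_two_pos_holds
  have hliY : t ≤ logIntegral Y := by
    rw [logIntegral_eq_offsetLogIntegral_add_logIntegral_two (by linarith [hY.2])]
    linarith [hY.1]
  have hcont : ContinuousOn logIntegral (Icc 2 Y) := fun y hy ↦
    (hasDerivAt_logIntegral_holds (show (1 : ℝ) < y by linarith [hy.1])).continuousAt.continuousWithinAt
  obtain ⟨y, hy, hy'⟩ := intermediate_value_Icc hY.2 hcont ⟨logIntegral_two_le_two.trans ht, hliY⟩
  exact ⟨y, hy.1, hy'⟩

/-! ### Assembly: if RH fails, `log g(n) > √(li⁻¹(n))` infinitely often; the `⟸` half of the MNR criterion -/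

/-- Auxiliary (proof-internal): eventually `2 x^{3/2} log x ≤ x^{1+b}` for `b > 1/2`. [folklore] -/
private theorem eventually_err_le {b : ℝ} (hb : 1 / 2 < b) :
    ∀ᶠ x : ℝ in atTop, 2 * x ^ (3 / 2 : ℝ) * Real.log x ≤ x ^ (1 + b) := by
  have h := (isLittleO_log_rpow_atTop (show 0 < b - 1 / 2 by linarith)).bound (show (0:ℝ) < 1 / 2 by norm_num)
  filter_upwards [h, eventually_ge_atTop 1] with x hx hx1
  have hx0 : 0 < x := by linarith
  rw [Real.norm_eq_abs, Real.norm_eq_abs, abs_of_nonneg (Real.log_nonneg hx1),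
    abs_of_pos (Real.rpow_pos_of_pos hx0 _)] at hx
  have hsplit : x ^ (1 + b) = x ^ (3 / 2 : ℝ) * x ^ (b - 1 / 2) := by
    rw [← Real.rpow_add hx0]; congr 1; ring
  rw [hsplit]
  have := Real.rpow_pos_of_pos hx0 (3 / 2 : ℝ)
  nlinarith

/-- **Massias–Nicolas–Robin 1988, Thm. 1 (ii), the `Ω₊` half, in sign form: if RH fails, then
`log g(n) > √(li⁻¹(n))` for infinitely many `n`** — precisely: for every `N` there are `n ≥ N` and
`y > 1` with `li(y) = n` and `√y < log g(n)`. Proof (MNR §6 with `n = ∑_{p ≤ x} p`, where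
`g(n) ≥ x#`, `log g(n) ≥ θ(x)`, in place of the element of `G` next to `g(n)`): at a zero `ρ₀` with
`Re ρ₀ > 1/2` (from `¬RH` and `ξ(s) = ξ(1−s)`) and `1/2 < b < Re ρ₀`, Lemma C gives
`K(x) ≥ x^{1+b}` for arbitrarily large `x`; then, by the convexity of `t ↦ li(t²)`,
`ψ − θ ≤ 2√x log x` and `∑_{p≤x} p ≤ Π₁(x)`,
`li(θ(x)²) − li(4) ≥ Π₁(x) + x^{1+b}/log x − 2x^{3/2} ≥ ∑_{p≤x} p = n = li(y)`, so `y < θ(x)²` and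
`√y < θ(x) ≤ log g(n)`. RH-FREE (an implication from `¬RH`).
[cite: MassiasNicolasRobin1988, Thm. 1 (ii) (Ω₊ part) and §6 (proof via Lemme C and convexity)] -/
theorem exists_sqrt_lt_log_landauFn_of_not_riemannHypothesis (hRH : ¬ RiemannHypothesis) (N : ℕ) :
    ∃ n : ℕ, N ≤ n ∧ ∃ y : ℝ, 1 < y ∧ logIntegral y = n ∧ Real.sqrt y < Real.log (landauFn n) := by
  -- a zero `ρ₀ = 1 + s₀` with `Re ρ₀ > 1/2`, and `b` with `1/2 < b < Re ρ₀`
  obtain ⟨s₀, hs₀, hre, -, -⟩ := Nicolas.exists_zero_right_of_not_RH hRH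
  obtain ⟨-, hζ⟩ := zetaOne_eq_zero_iff.1 hs₀
  have hρre : 1 / 2 < (1 + s₀).re := by simp; linarith
  set b : ℝ := (1 / 2 + (1 + s₀).re) / 2 with hb
  have hb1 : 1 / 2 < b := by rw [hb]; linarith
  have hb2 : b < (1 + s₀).re := by rw [hb]; linarith
  have hfreq := (frequently_le_mnrK_and_mnrK_le hζ (by linarith) hb2 one_pos).1
  -- eventual facts
  have he2 : (2 : ℝ) < Real.exp 1 := by have := Real.exp_one_gt_d9; linarith
  have hE1 : ∀ᶠ x : ℝ in atTop, Real.exp 1 ≤ θ x := by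
    filter_upwards [RobinOscillation.eventually_theta_ge_half, eventually_ge_atTop (2 * Real.exp 1)]
      with x hx hx2
    linarith
  have hE2 := eventually_err_le hb1
  obtain ⟨M, hM⟩ := tendsto_atTop_atTop.1 tendsto_primeSum_atTop (max N 2)
  have hE3 : ∀ᶠ x : ℝ in atTop, max N 2 ≤ primeSum ⌊x⌋₊ :=
    (tendsto_nat_floor_atTop.eventually (eventually_ge_atTop M)).mono fun x hx ↦ hM _ hx
  obtain ⟨x, hK, hθe, herr, hn, hxe⟩ :=
    (hfreq.and_eventually (hE1.and (hE2.and (hE3.and (eventually_ge_atTop (Real.exp 1)))))).exists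
  rw [one_mul] at hK
  -- abbreviations
  have hx2 : 2 < x := he2.trans_le hxe
  have hx0 : 0 < x := by linarith
  have hx1 : 1 < x := by linarith
  have hlog : 0 < Real.log x := Real.log_pos hx1
  set n : ℕ := primeSum ⌊x⌋₊ with hndef
  have hNn : N ≤ n := (le_max_left _ _).trans hn
  have hn2 : 2 ≤ n := (le_max_right _ _).trans hn
  -- the chain of inequalities: `li(θ²) − li(4) = J(θ) ≥ n`
  have hθ2 : 2 ≤ θ x := he2.le.trans hθe
  have hconv := mul_div_log_le_liSq_sub hxe hθe
  have hψθ : ψ x - θ x ≤ 2 * Real.sqrt x * Real.log x := Chebyshev.psi_sub_theta_le hx1.le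
  have hsqrt : Real.sqrt x = x ^ (1 / 2 : ℝ) := Real.sqrt_eq_rpow x
  have hx32 : x ^ (3 / 2 : ℝ) = x * x ^ (1 / 2 : ℝ) := by
    rw [show (3 / 2 : ℝ) = 1 + 1 / 2 by norm_num, Real.rpow_add hx0, Real.rpow_one]
  -- from `K(x) ≥ x^{1+b}`: `x(ψ − x) ≥ P₁ log x + x^{1+b}`
  have hK' : pOne x * Real.log x + x ^ (1 + b) ≤ x * (ψ x - x) := by
    simp only [mnrK] at hK; linarith
  -- `J(θ) − J(x) ≥ (θ − x) x/log x ≥ (x(ψ−x) − 2 x^{3/2} log x)/log x`... multiply through by `log x`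
  have hmain : (primePowerPi1 x) * Real.log x ≤ liSq (θ x) * Real.log x := by
    have h1 : (θ x - x) * (x / Real.log x) * Real.log x = (θ x - x) * x := by
      field_simp
    have h2 : liSq x * Real.log x + (θ x - x) * x ≤ liSq (θ x) * Real.log x := by
      have := mul_le_mul_of_nonneg_right hconv hlog.le
      rw [sub_mul] at this
      linarith [h1]
    -- `(θ − x) x ≥ x(ψ − x) − 2 x^{3/2} log x ≥ P₁ log x + x^{1+b} − 2x^{3/2} log x ≥ P₁ log x`
    have h3 : x * (ψ x - x) - 2 * x ^ (3 / 2 : ℝ) * Real.log x ≤ (θ x - x) * x := by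
      rw [hx32, ← hsqrt]
      nlinarith [Real.sqrt_nonneg x]
    have h4 : pOne x = primePowerPi1 x - liSq x := rfl
    nlinarith
  have hJ : (n : ℝ) ≤ liSq (θ x) :=
    (primeSum_le_primePowerPi1 x).trans (le_of_mul_le_mul_right hmain hlog)
  -- `y` with `li(y) = n`; then `li(y) = n < li(θ²)`, so `y < θ²`
  obtain ⟨y, hy2, hy⟩ := exists_logIntegral_eq (t := n) (by exact_mod_cast hn2)
  have hy1 : 1 < y := by linarith
  refine ⟨n, hNn, y, hy1, hy, ?_⟩
  have hlt : logIntegral y < logIntegral (θ x ^ 2) := by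
    rw [hy, logIntegral_sq_eq hθ2]
    linarith [logIntegral_four_pos]
  have hyθ : y < θ x ^ 2 := by
    by_contra h
    have hge : θ x ^ 2 ≤ y := not_lt.1 h
    have := strictMonoOn_logIntegral_holds.le_iff_le (show θ x ^ 2 ∈ Ioi (1:ℝ) by
      show (1:ℝ) < θ x ^ 2; nlinarith) (show y ∈ Ioi (1:ℝ) from hy1)
    exact absurd (this.2 hge) (not_le.2 hlt)
  calc Real.sqrt y < Real.sqrt (θ x ^ 2) := Real.sqrt_lt_sqrt (by linarith) hyθ
    _ = θ x := Real.sqrt_sq (by linarith)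
    _ ≤ Real.log (landauFn n) := theta_le_log_landauFn_primeSum x

/-- **The `⟸` half of the Massias–Nicolas–Robin criterion, PROVED**: if `log g(n) < √(li⁻¹(n))` for
all sufficiently large `n` (encoded as in `MassiasNicolasRobin1988_iff`: `∀ y > 1, li y = n → …`), then
the Riemann hypothesis holds (contrapositive of MNR Thm. 1 (ii), `Ω₊` part; Broughan vol. 1, Ch. 10,
"the symmetric group" criterion). RH-FREE (an implication; nothing is asserted about RH).
[cite: MassiasNicolasRobin1988, Thm. 1 (ii)–(iv); Broughan2017Arithmetic, Ch. 10 (symmetric group criterion)] -/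
theorem riemannHypothesis_of_eventually_log_landauFn_lt
    (h : ∃ n₀ : ℕ, ∀ n : ℕ, n₀ ≤ n → ∀ y : ℝ, 1 < y → logIntegral y = n →
      Real.log (landauFn n) < Real.sqrt y) : RiemannHypothesis := by
  by_contra hRH
  obtain ⟨n₀, hn₀⟩ := h
  obtain ⟨n, hn, y, hy1, hy, hlt⟩ := exists_sqrt_lt_log_landauFn_of_not_riemannHypothesis hRH n₀
  exact absurd (hn₀ n hn y hy1 hy) (not_lt.2 hlt.le)

end LandauFnOmega

/-- **`MassiasNicolasRobin1988_iff` from `DelegliseNicolas2019_iff` alone**: the asymptotic criterion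
`RH ⟺ log g(n) < √(li⁻¹(n))` for all large `n` now follows from the sharp one (its `⟹` half) and the
PROVED `⟸` half `LandauFnOmega.riemannHypothesis_of_eventually_log_landauFn_lt` (MNR Thm. 1 (ii)).
RH-EQUIVALENT (derived from the remaining named fact; neither side asserted).
[cite: MassiasNicolasRobin1988, Thm. 1 (ii), (iv); DelegliseNicolas2019, Thm. 1.1 (i) and Cor. 1.3] -/
theorem MassiasNicolasRobin1988_iff_of_delegliseNicolas2019 (hDN : DelegliseNicolas2019_iff) :
    MassiasNicolasRobin1988_iff :=
  MassiasNicolasRobin1988_iff_of hDN LandauFnOmega.riemannHypothesis_of_eventually_log_landauFn_lt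

/-- **The `⟸` half of the symmetric-group criterion, unconditional form**: `¬RH` implies that
`log g(n) < √(li⁻¹(n))` fails for infinitely many `n` (MNR Thm. 1 (ii), `Ω₊`). RH-FREE.
[cite: MassiasNicolasRobin1988, Thm. 1 (ii)] -/
theorem frequently_sqrt_liInv_lt_log_landauFn_of_not_riemannHypothesis (hRH : ¬ RiemannHypothesis) :
    ∃ᶠ n : ℕ in atTop, ∃ y : ℝ, 1 < y ∧ logIntegral y = n ∧ Real.sqrt y < Real.log (landauFn n) := by
  refine frequently_atTop.2 fun N ↦ ?_
  obtain ⟨n, hn, y, hy⟩ := LandauFnOmega.exists_sqrt_lt_log_landauFn_of_not_riemannHypothesis hRH N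
  exact ⟨n, hn, y, hy⟩

/-! ### MNR Thm. 1 (ii), `Ω₊` part, with the printed magnitude `(n log n)^{ξ/2}` (appended) -/

namespace LandauFnOmega

open Landau Nicolas PiLi

/-- Auxiliary (proof-internal): eventually `4 x^{3/2} log x ≤ x^{1+b}` for `b > 1/2`. [folklore] -/
private theorem eventually_err_le_half {b : ℝ} (hb : 1 / 2 < b) :
    ∀ᶠ x : ℝ in atTop, 4 * x ^ (3 / 2 : ℝ) * Real.log x ≤ x ^ (1 + b) := by
  have h := (isLittleO_log_rpow_atTop (show 0 < b - 1 / 2 by linarith)).bound (show (0:ℝ) < 1 / 4 by norm_num)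
  filter_upwards [h, eventually_ge_atTop 1] with x hx hx1
  have hx0 : 0 < x := by linarith
  rw [Real.norm_eq_abs, Real.norm_eq_abs, abs_of_nonneg (Real.log_nonneg hx1),
    abs_of_pos (Real.rpow_pos_of_pos hx0 _)] at hx
  have hsplit : x ^ (1 + b) = x ^ (3 / 2 : ℝ) * x ^ (b - 1 / 2) := by
    rw [← Real.rpow_add hx0]; congr 1; ring
  rw [hsplit]
  have := Real.rpow_pos_of_pos hx0 (3 / 2 : ℝ)
  nlinarith

/-- Auxiliary (proof-internal): eventually `2 x^ξ log x ≤ (1/10) x^b / log x` for `ξ < b`. [folklore] -/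
private theorem eventually_main_le {ξ b : ℝ} (hξb : ξ < b) :
    ∀ᶠ x : ℝ in atTop, 2 * x ^ ξ * Real.log x ≤ 1 / 10 * x ^ b / Real.log x := by
  have h := (isLittleO_log_rpow_atTop (show 0 < (b - ξ) / 2 by linarith)).bound
    (show (0:ℝ) < 1 / 5 by norm_num)
  filter_upwards [h, eventually_gt_atTop 1] with x hx hx1
  have hx0 : 0 < x := by linarith
  have hlog : 0 < Real.log x := Real.log_pos hx1
  rw [Real.norm_eq_abs, Real.norm_eq_abs, abs_of_nonneg hlog.le,
    abs_of_pos (Real.rpow_pos_of_pos hx0 _)] at hx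
  rw [le_div_iff₀ hlog]
  have hsplit : x ^ b = x ^ ξ * (x ^ ((b - ξ) / 2) * x ^ ((b - ξ) / 2)) := by
    rw [← Real.rpow_add hx0, ← Real.rpow_add hx0]; congr 1; ring
  rw [hsplit]
  have h1 := Real.rpow_pos_of_pos hx0 ξ
  have h2 := Real.rpow_pos_of_pos hx0 ((b - ξ) / 2)
  have h3 : Real.log x * Real.log x ≤ (1 / 5 * x ^ ((b - ξ) / 2)) * (1 / 5 * x ^ ((b - ξ) / 2)) :=
    mul_le_mul hx hx hlog.le (by positivity)
  nlinarith [mul_pos h1 hlog]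

/-- Auxiliary (proof-internal): `(n log n)^{ξ/2} ≤ 2 x^ξ log x` when `2 ≤ n ≤ x²`, `x ≥ e`, `0 ≤ ξ ≤ 1`.
[folklore] -/
private theorem rpow_nlogn_le {n x ξ : ℝ} (hn : 2 ≤ n) (hnx : n ≤ x ^ 2) (hx : Real.exp 1 ≤ x)
    (hξ0 : 0 ≤ ξ) (hξ1 : ξ ≤ 1) :
    (n * Real.log n) ^ (ξ / 2) ≤ 2 * x ^ ξ * Real.log x := by
  have hx0 : 0 < x := (Real.exp_pos 1).trans_le hx
  have hlogx : 1 ≤ Real.log x := by rwa [Real.le_log_iff_exp_le hx0]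
  have hn0 : 0 < n := by linarith
  have hlogn : 0 ≤ Real.log n := Real.log_nonneg (by linarith)
  have hlogn2 : Real.log n ≤ 2 * Real.log x := by
    calc Real.log n ≤ Real.log (x ^ 2) := Real.log_le_log hn0 hnx
      _ = 2 * Real.log x := by rw [Real.log_pow]; push_cast; ring
  have h1 : n * Real.log n ≤ 2 * (x ^ 2 * Real.log x) := by nlinarith
  have h2 : (n * Real.log n) ^ (ξ / 2) ≤ (2 * (x ^ 2 * Real.log x)) ^ (ξ / 2) :=
    Real.rpow_le_rpow (mul_nonneg hn0.le hlogn) h1 (by linarith)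
  have h3 : (2 * (x ^ 2 * Real.log x)) ^ (ξ / 2) = (2 : ℝ) ^ (ξ / 2) * (x ^ ξ * Real.log x ^ (ξ / 2)) := by
    rw [Real.mul_rpow (by norm_num) (by positivity), Real.mul_rpow (by positivity) (by positivity),
      show (x ^ 2 : ℝ) = x ^ (2 : ℝ) by norm_cast, ← Real.rpow_mul hx0.le]
    congr 2; ring_nf
  have h4 : (2 : ℝ) ^ (ξ / 2) ≤ 2 := by
    calc (2 : ℝ) ^ (ξ / 2) ≤ (2 : ℝ) ^ (1 : ℝ) := Real.rpow_le_rpow_of_exponent_le (by norm_num) (by linarith)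
      _ = 2 := Real.rpow_one 2
  have h5 : Real.log x ^ (ξ / 2) ≤ Real.log x := by
    calc Real.log x ^ (ξ / 2) ≤ Real.log x ^ (1 : ℝ) := Real.rpow_le_rpow_of_exponent_le hlogx (by linarith)
      _ = Real.log x := Real.rpow_one _
  have h6 : 0 ≤ x ^ ξ := (Real.rpow_pos_of_pos hx0 ξ).le
  have h7 : 0 ≤ Real.log x ^ (ξ / 2) := Real.rpow_nonneg (by linarith) _
  calc (n * Real.log n) ^ (ξ / 2) ≤ (2 : ℝ) ^ (ξ / 2) * (x ^ ξ * Real.log x ^ (ξ / 2)) := h2.trans_eq h3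
    _ ≤ 2 * (x ^ ξ * Real.log x) := mul_le_mul h4 (mul_le_mul_of_nonneg_left h5 h6) (by positivity) (by norm_num)
    _ = 2 * x ^ ξ * Real.log x := by ring

/-- **Massias–Nicolas–Robin 1988, Thm. 1 (ii), the `Ω₊` half with the printed magnitude, at a zero.**
Let `ρ₀` be a zero of `ζ` with `Re ρ₀ > 1/2` and `ξ < Re ρ₀`. Then for every `N` there are `n ≥ N` and
`y > 1` with `li(y) = n` (i.e. `y = li⁻¹(n)`) and `log g(n) ≥ √y + (n log n)^{ξ/2}` — MNR: "Si `θ > 1/2`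
on a pour tout `ξ < θ`: `log g(n) = √(Li⁻¹(n)) + Ω±((n log n)^{ξ/2})`", the `Ω₊` part (any constant in
front of `(n log n)^{ξ/2}` may be taken, `ξ` being free below `Re ρ₀`). Proof: as
`exists_sqrt_lt_log_landauFn_of_not_riemannHypothesis`, keeping the margin: with `max(ξ,1/2) < b < Re ρ₀`
and `n = ∑_{p≤x} p ≤ x²`, Lemma C gives `li(θ(x)²) − li(y) ≥ x^{1+b}/(2 log x)`, hence
`θ(x)² − y ≥ (log 2) x^{1+b}/(2 log x)` (`li' ≤ 1/log 2` on `[y, θ²]`), `θ(x) − √y ≥ x^b/(10 log x)`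
(`θ + √y ≤ 2θ ≤ 2 log 4 · x`), which dominates `(n log n)^{ξ/2} ≤ 2 x^ξ log x`. RH-FREE (a theorem about a
hypothetical zero off the line). [cite: MassiasNicolasRobin1988, Thm. 1 (ii) (Ω₊ part) and §6] -/
theorem exists_sqrt_add_rpow_le_log_landauFn {ρ₀ : ℂ} (h0 : riemannZeta ρ₀ = 0) (hρ : 1 / 2 < ρ₀.re)
    {ξ : ℝ} (hξ : ξ < ρ₀.re) (N : ℕ) :
    ∃ n : ℕ, N ≤ n ∧ ∃ y : ℝ, 1 < y ∧ logIntegral y = n ∧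
      Real.sqrt y + ((n : ℝ) * Real.log n) ^ (ξ / 2) ≤ Real.log (landauFn n) := by
  -- reduce to `1/2 < ξ₁ < Re ρ₀`, `ξ ≤ ξ₁ ≤ 1`
  have hρ1 : ρ₀.re < 1 := by
    by_contra h
    exact riemannZeta_ne_zero_of_one_le_re (not_lt.1 h) h0
  set ξ₁ : ℝ := (max ξ (1 / 2) + ρ₀.re) / 2 with hξ₁
  have hmax : max ξ (1 / 2) < ρ₀.re := max_lt hξ hρ
  have hξ₁a : 1 / 2 < ξ₁ := by rw [hξ₁]; linarith [le_max_right ξ (1 / 2)]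
  have hξ₁b : ξ₁ < ρ₀.re := by rw [hξ₁]; linarith
  have hξξ₁ : ξ ≤ ξ₁ := by rw [hξ₁]; linarith [le_max_left ξ (1 / 2)]
  have hξ₁1 : ξ₁ ≤ 1 := by linarith
  set b : ℝ := (ξ₁ + ρ₀.re) / 2 with hb
  have hb1 : ξ₁ < b := by rw [hb]; linarith
  have hb2 : b < ρ₀.re := by rw [hb]; linarith
  have hbhalf : 1 / 2 < b := hξ₁a.trans hb1
  have hfreq := (frequently_le_mnrK_and_mnrK_le h0 (by linarith) hb2 one_pos).1
  -- eventual facts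
  have he2 : (2 : ℝ) < Real.exp 1 := by have := Real.exp_one_gt_d9; linarith
  have hE1 : ∀ᶠ x : ℝ in atTop, Real.exp 1 ≤ θ x := by
    filter_upwards [RobinOscillation.eventually_theta_ge_half, eventually_ge_atTop (2 * Real.exp 1)]
      with x hx hx2
    linarith
  have hE2 := eventually_err_le_half hbhalf
  have hE4 := eventually_main_le hb1
  obtain ⟨M, hM⟩ := tendsto_atTop_atTop.1 tendsto_primeSum_atTop (max N 2)
  have hE3 : ∀ᶠ x : ℝ in atTop, max N 2 ≤ primeSum ⌊x⌋₊ :=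
    (tendsto_nat_floor_atTop.eventually (eventually_ge_atTop M)).mono fun x hx ↦ hM _ hx
  obtain ⟨x, hK, hθe, herr, hmainle, hn, hxe⟩ :=
    (hfreq.and_eventually (hE1.and (hE2.and (hE4.and (hE3.and (eventually_ge_atTop (Real.exp 1))))))).exists
  rw [one_mul] at hK
  have hx2 : 2 < x := he2.trans_le hxe
  have hx0 : 0 < x := by linarith
  have hx1 : 1 < x := by linarith
  have hlog : 0 < Real.log x := Real.log_pos hx1
  have hlog1 : 1 ≤ Real.log x := by rwa [Real.le_log_iff_exp_le hx0]
  set n : ℕ := primeSum ⌊x⌋₊ with hndef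
  have hNn : N ≤ n := (le_max_left _ _).trans hn
  have hn2 : 2 ≤ n := (le_max_right _ _).trans hn
  have hθ2 : 2 ≤ θ x := he2.le.trans hθe
  have hθ0 : 0 < θ x := by linarith
  -- the chain with the margin kept: `J(θ) log x ≥ Π₁ log x + x^{1+b}/2`
  have hconv := mul_div_log_le_liSq_sub hxe hθe
  have hψθ : ψ x - θ x ≤ 2 * Real.sqrt x * Real.log x := Chebyshev.psi_sub_theta_le hx1.le
  have hsqrt : Real.sqrt x = x ^ (1 / 2 : ℝ) := Real.sqrt_eq_rpow x
  have hx32 : x ^ (3 / 2 : ℝ) = x * x ^ (1 / 2 : ℝ) := by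
    rw [show (3 / 2 : ℝ) = 1 + 1 / 2 by norm_num, Real.rpow_add hx0, Real.rpow_one]
  have hK' : pOne x * Real.log x + x ^ (1 + b) ≤ x * (ψ x - x) := by
    simp only [mnrK] at hK; linarith
  have hmain : primePowerPi1 x * Real.log x + x ^ (1 + b) / 2 ≤ liSq (θ x) * Real.log x := by
    have h1 : (θ x - x) * (x / Real.log x) * Real.log x = (θ x - x) * x := by field_simp
    have h2 : liSq x * Real.log x + (θ x - x) * x ≤ liSq (θ x) * Real.log x := by
      have := mul_le_mul_of_nonneg_right hconv hlog.le
      rw [sub_mul] at this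
      linarith [h1]
    have h3 : x * (ψ x - x) - 2 * x ^ (3 / 2 : ℝ) * Real.log x ≤ (θ x - x) * x := by
      rw [hx32, ← hsqrt]
      have := mul_le_mul_of_nonneg_left hψθ hx0.le
      nlinarith only [this]
    have h4 : pOne x * Real.log x = primePowerPi1 x * Real.log x - liSq x * Real.log x := by
      simp only [pOne]; ring
    linarith
  have hJ : (n : ℝ) + x ^ (1 + b) / (2 * Real.log x) ≤ liSq (θ x) := by
    have h1 := primeSum_le_primePowerPi1 x
    rw [← hndef] at h1
    have h2 : ((n : ℝ) + x ^ (1 + b) / (2 * Real.log x)) * Real.log x ≤ liSq (θ x) * Real.log x := by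
      have : ((n : ℝ) + x ^ (1 + b) / (2 * Real.log x)) * Real.log x =
          (n : ℝ) * Real.log x + x ^ (1 + b) / 2 := by field_simp
      rw [this]
      have h1' := mul_le_mul_of_nonneg_right h1 hlog.le
      linarith
    exact le_of_mul_le_mul_right h2 hlog
  -- `y = li⁻¹(n)`
  obtain ⟨y, hy2, hy⟩ := exists_logIntegral_eq (t := n) (by exact_mod_cast hn2)
  have hy1 : 1 < y := by linarith
  have hy0 : 0 ≤ y := by linarith
  refine ⟨n, hNn, y, hy1, hy, ?_⟩
  have hmargin : 0 < x ^ (1 + b) / (2 * Real.log x) := by positivity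
  -- `li(θ²) − li(y) ≥ margin`, so `y < θ²` and `θ² − y ≥ (log 2)·margin ≥ margin/2`
  have hliθ : logIntegral (θ x ^ 2) = liSq (θ x) + logIntegral 4 := logIntegral_sq_eq hθ2
  have hli4 := logIntegral_four_pos
  have hdiff : x ^ (1 + b) / (2 * Real.log x) ≤ logIntegral (θ x ^ 2) - logIntegral y := by
    rw [hliθ, hy]; linarith
  have hyθ : y < θ x ^ 2 := by
    by_contra h
    have hge : θ x ^ 2 ≤ y := not_lt.1 h
    have hθsq : (1:ℝ) < θ x ^ 2 := by nlinarith only [hθ2]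
    have hmono : StrictMonoOn logIntegral (Ioi 1) := strictMonoOn_logIntegral_holds
    have h' := (hmono.le_iff_le hθsq hy1).2 hge
    linarith
  have hsub : logIntegral (θ x ^ 2) - logIntegral y ≤ (θ x ^ 2 - y) / Real.log y :=
    RobinLiTheta.logIntegral_sub_le_sub_div_log hy1 hyθ.le
  have hlogy : Real.log 2 ≤ Real.log y := Real.log_le_log two_pos hy2
  have hl2 := Real.log_two_gt_d9
  have hlogy0 : 0 < Real.log y := by linarith
  have hθy : Real.log 2 * (x ^ (1 + b) / (2 * Real.log x)) ≤ θ x ^ 2 - y := by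
    have h1 : x ^ (1 + b) / (2 * Real.log x) * Real.log y ≤ θ x ^ 2 - y := by
      have := hdiff.trans hsub
      rwa [le_div_iff₀ hlogy0] at this
    have h2 : Real.log 2 * (x ^ (1 + b) / (2 * Real.log x)) ≤
        Real.log y * (x ^ (1 + b) / (2 * Real.log x)) := mul_le_mul_of_nonneg_right hlogy hmargin.le
    linarith
  -- `θ − √y ≥ (θ² − y)/(2θ)` and `θ ≤ log 4 · x`
  have hθx : θ x ≤ Real.log 4 * x := Chebyshev.theta_le_log4_mul_x hx0.le
  have hl4 : Real.log 4 < 1.4 := by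
    rw [show (4:ℝ) = 2 ^ 2 by norm_num, Real.log_pow]; push_cast
    have := Real.log_two_lt_d9; linarith
  have hsqy : Real.sqrt y < θ x := by
    calc Real.sqrt y < Real.sqrt (θ x ^ 2) := Real.sqrt_lt_sqrt hy0 hyθ
      _ = θ x := Real.sqrt_sq hθ0.le
  have hprod : (θ x - Real.sqrt y) * (θ x + Real.sqrt y) = θ x ^ 2 - y := by
    have := Real.sq_sqrt hy0
    linear_combination (-1 : ℝ) * this
  set A : ℝ := θ x - Real.sqrt y with hAdef
  have hA0 : 0 ≤ A := by rw [hAdef]; linarith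
  set Q : ℝ := x ^ b / Real.log x with hQdef
  have hQ0 : 0 ≤ Q := div_nonneg (Real.rpow_pos_of_pos hx0 b).le hlog.le
  have hgap : 1 / 10 * Q ≤ A := by
    -- `A · 2θ ≥ θ² − y ≥ log 2 · x^{1+b}/(2 log x) = log 2 · x Q/2` and `2θ ≤ 2.8 x`
    have h1 : θ x ^ 2 - y ≤ A * (2 * θ x) := by
      rw [← hprod]
      exact mul_le_mul_of_nonneg_left (by linarith [Real.sqrt_nonneg y]) hA0
    have hl4x : Real.log 4 * x ≤ 1.4 * x := mul_le_mul_of_nonneg_right hl4.le hx0.le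
    have h3 : A * (2 * θ x) ≤ A * (2.8 * x) :=
      mul_le_mul_of_nonneg_left (by linarith) hA0
    have hxb : x ^ (1 + b) / (2 * Real.log x) = x * (Q / 2) := by
      rw [Real.rpow_add hx0, Real.rpow_one, hQdef]
      field_simp
    rw [hxb] at hθy
    have h5 : x * (Real.log 2 * (Q / 2)) ≤ x * (2.8 * A) := by
      have := (hθy.trans h1).trans h3
      nlinarith only [this]
    have h6 : Real.log 2 * (Q / 2) ≤ 2.8 * A := le_of_mul_le_mul_left h5 hx0
    have h7 : 0.6931471803 * Q ≤ Real.log 2 * Q := mul_le_mul_of_nonneg_right hl2.le hQ0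
    linarith
  -- `(n log n)^{ξ/2} ≤ (n log n)^{ξ₁/2} ≤ 2 x^{ξ₁} log x ≤ x^b/(10 log x) ≤ θ − √y`
  have hnx : (n : ℝ) ≤ x ^ 2 := (primeSum_le_primePowerPi1 x).trans (primePowerPi1_le hx0.le)
  have hn2r : (2 : ℝ) ≤ n := by exact_mod_cast hn2
  have hnlog1 : 1 ≤ (n : ℝ) * Real.log n := by
    have h1 : Real.log 2 ≤ Real.log n := Real.log_le_log two_pos hn2r
    have h2 : 2 * Real.log 2 ≤ (n : ℝ) * Real.log n :=
      mul_le_mul hn2r h1 (by linarith) (by linarith)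
    linarith
  calc Real.sqrt y + ((n : ℝ) * Real.log n) ^ (ξ / 2)
      ≤ Real.sqrt y + ((n : ℝ) * Real.log n) ^ (ξ₁ / 2) :=
        add_le_add le_rfl (Real.rpow_le_rpow_of_exponent_le hnlog1 (by linarith))
    _ ≤ Real.sqrt y + 2 * x ^ ξ₁ * Real.log x :=
        add_le_add le_rfl (rpow_nlogn_le hn2r hnx hxe (by linarith) hξ₁1)
    _ ≤ Real.sqrt y + 1 / 10 * Q := by
        have : 1 / 10 * x ^ b / Real.log x = 1 / 10 * Q := by simp only [hQdef, mul_div_assoc]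
        linarith
    _ ≤ θ x := by rw [hAdef] at hgap; linarith
    _ ≤ Real.log (landauFn n) := theta_le_log_landauFn_primeSum x

/-- **MNR 1988, Thm. 1 (ii) `Ω₊` under `¬RH`, as recalled by Deléglise–Nicolas 2019 (proof of Cor. 1.3):
"if the Riemann hypothesis fails … there exists `b > 1/4` such that `log g(n) = √(li⁻¹(n)) + Ω±((n log n)^b)`"
— the `Ω₊` half**: `¬RH ⟹ ∃ b > 1/4` such that `log g(n) ≥ √(li⁻¹(n)) + (n log n)^b` for infinitely
many `n`. RH-FREE (an implication from `¬RH`). [cite: MassiasNicolasRobin1988, Thm. 1 (ii); DelegliseNicolas2019, proof of Cor. 1.3 and (1.12)] -/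
theorem exists_gt_quarter_sqrt_add_rpow_le_of_not_riemannHypothesis (hRH : ¬ RiemannHypothesis) :
    ∃ b : ℝ, 1 / 4 < b ∧ ∀ N : ℕ, ∃ n : ℕ, N ≤ n ∧ ∃ y : ℝ, 1 < y ∧ logIntegral y = n ∧
      Real.sqrt y + ((n : ℝ) * Real.log n) ^ b ≤ Real.log (landauFn n) := by
  obtain ⟨s₀, hs₀, hre, -, -⟩ := Nicolas.exists_zero_right_of_not_RH hRH
  obtain ⟨-, hζ⟩ := zetaOne_eq_zero_iff.1 hs₀
  have hρre : 1 / 2 < (1 + s₀).re := by simp; linarith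
  set ξ : ℝ := (1 / 2 + (1 + s₀).re) / 2 with hξ
  have hξ1 : 1 / 2 < ξ := by rw [hξ]; linarith
  have hξ2 : ξ < (1 + s₀).re := by rw [hξ]; linarith
  refine ⟨ξ / 2, by linarith, fun N ↦ ?_⟩
  exact exists_sqrt_add_rpow_le_log_landauFn hζ hρre hξ2 N

end LandauFnOmega

end Literature.NumberTheory.LFunctions

end
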